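import Literature.Barriers.CriticalPhenomena.GridSAWFormulaTiling
import HarnessLib

/-!
# The tiling of the grid drawing of the graph of a formula, IV: names

The global names given by the placements of `GridSAWFormulaTiling.lean` (the grid drawing `E₀` of
`GridFormula.graphOf ψ`; Liśkiewicz–Ogihara–Toda 2003, Lemma 4 / Theorem 7, tree fact
`GridSAW.LOT2003_lemma4_gadgets`) decoded: every name a placed tile gives to one of its local
vertices is the number of a STRUCTURED vertex of the graph (`SSem`: block vertex / connector of a
tile cell, of the doubling cell, of a clause-row terminal; inner vertex of a tile gadget, of a
landing gadget, of a clause OR-gadget), and the numbering `encS` is injective on well-formed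
structured vertices. This is the arithmetic half of "equal names ⇒ equal positions"
(`GridSAWFormulaTilingPos.lean`).

* `SSem`, `SSem.WF`, `encS`, **`encS_injective`**;
* `ssemM`, `ssemC`, `ssemR` (the structured vertex of a role in a matrix / clause / rung
  placement) with `matrixP_ν`, `clauseP_ν`, `rungP_ν` (the names ARE the numbers of these) and
  their well-formedness `ssemM_wf`, … from the facts `RoleAtOK` of `GridSAWFormulaTilingKinds.lean`;
* the column decomposition `exists_cstart_add` and `V_le_N`.

## References

* M. Liśkiewicz, M. Ogihara, S. Toda, TCS 304 (2003) 129–156, §4 (proof of Theorem 7, `E₀`).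
-/

namespace Literature.Barriers.CriticalPhenomena.GridSAW

namespace FormulaTiles

open Literature.Computability.Complexity (CNF)
open Literature.Combinatorics.SimpleGraph Literature.Combinatorics.SimpleGraph.GridFormula
open Literature.Combinatorics.SimpleGraph.GridFormula.Slot
open Literature.Combinatorics.SimpleGraph.GridCell (conn vtx)

variable (ψ : CNF ℕ)

/-! ### Column decomposition and `V ≤ N` -/

/-- `firstOccs` does not lengthen beyond the inputs. [folklore] -/
theorem length_firstOccs_le : ∀ (acc l : List ℕ), (firstOccs acc l).length ≤ acc.length + l.length
  | acc, [] => by simp [firstOccs]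
  | acc, x :: l => by
    unfold firstOccs insertNew
    split_ifs
    · exact (length_firstOccs_le acc l).trans (by simp)
    · exact (length_firstOccs_le (acc ++ [x]) l).trans (by simp; omega)

/-- **There are at most as many rows as columns.** [folklore] -/
theorem V_le_N : V ψ ≤ N ψ := by
  unfold V varRows N
  have := length_firstOccs_le [] ((cols ψ).map Prod.fst)
  simpa using this

/-- `cstart` is constant from `|ψ|` on. [folklore] -/
theorem cstart_of_le {q : ℕ} (hq : ψ.length ≤ q) : cstart ψ q = N ψ := by
  unfold cstart N cols
  rw [List.take_of_length_le hq]

/-- **Every column lies in a clause**: `j = cstart q + m` with `m < |ψ[q]|`. [folklore] -/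
theorem exists_cstart_add {j : ℕ} (hj : j < N ψ) : ∃ q, ∃ hq : q < ψ.length, ∃ m < ψ[q].length, j = cstart ψ q + m := by
  classical
  have hex : ∃ q, j < cstart ψ (q + 1) := ⟨ψ.length, by rw [cstart_of_le ψ (by omega)]; exact hj⟩
  let q₀ := Nat.find hex
  have hq₀ : j < cstart ψ (q₀ + 1) := Nat.find_spec hex
  have hle : cstart ψ q₀ ≤ j := by
    rcases Nat.eq_zero_or_pos q₀ with h0 | hpos
    · rw [h0]; simp
    · have hmin := Nat.find_min hex (show q₀ - 1 < q₀ by omega)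
      rw [show q₀ - 1 + 1 = q₀ by omega] at hmin
      omega
  have hql : q₀ < ψ.length := by
    by_contra hge
    rw [cstart_of_le ψ (by omega)] at hle
    omega
  refine ⟨q₀, hql, j - cstart ψ q₀, ?_, by omega⟩
  rw [cstart_succ ψ hql] at hq₀
  omega

/-- The clause and the offset of a column. [folklore] -/
theorem colClause_spec {j : ℕ} (hj : j < N ψ) :
    colClause ψ j < ψ.length ∧ colInClause ψ j < (ψ.map List.length).getD (colClause ψ j) 0 ∧
      j = cstart ψ (colClause ψ j) + colInClause ψ j := by
  obtain ⟨q, hq, m, hm, rfl⟩ := exists_cstart_add ψ hj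
  have hcc := colClause_cstart_add ψ hq hm
  unfold colInClause
  rw [hcc, getD_map_length' ψ hq]
  exact ⟨hq, by simpa using hm, by omega⟩

/-! ### Structured vertices and their numbers -/

/-- **A structured vertex of `graphOf ψ`.** [folklore] -/
inductive SSem
  /-- block vertex `b` of cell `c ≤ 2` of tile `(i, j)` -/
  | cellV (i j c b : ℕ)
  /-- connector of cell `c ≤ 2` of tile `(i, j)` -/
  | tconn (i j c : ℕ)
  /-- block vertex `b` of the doubling cell -/
  | dcellV (b : ℕ)
  /-- the start connector -/
  | sconn
  /-- block vertex `b` of the clause-row terminal of column `j` -/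
  | beadV (j b : ℕ)
  /-- connector of the clause-row terminal of column `j` -/
  | bconnS (j : ℕ)
  /-- inner vertex `code` of gadget `r` of tile `(i, j)` -/
  | tgad (i j r code : ℕ)
  /-- inner vertex `code` of the landing gadget of column `j` -/
  | landS (j code : ℕ)
  /-- inner vertex `code` of the OR-gadget of clause `q` -/
  | orS (q code : ℕ)
  deriving DecidableEq, Repr

namespace SSem

variable {ψ}

/-- Well-formedness: indices in range. [folklore] -/
def WF (ψ : CNF ℕ) : SSem → Prop
  | cellV i j c b => i < V ψ ∧ j < N ψ ∧ c ≤ 2 ∧ b < 16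
  | tconn i j c => i < V ψ ∧ j < N ψ ∧ c ≤ 2
  | dcellV b => b < 16
  | sconn => True
  | beadV j b => j < N ψ ∧ b < 16
  | bconnS j => j < N ψ
  | tgad i j r code => i < V ψ ∧ j < N ψ ∧ r < 8 ∧ code < 64
  | landS j code => j < N ψ ∧ code < 64
  | orS _ code => code < 64

/-- **The number of a structured vertex.** [folklore] -/
def encS (ψ : CNF ℕ) : SSem → ℕ
  | cellV i j c b => 17 * tileCell ψ i j c + 1 + b
  | tconn i j c => 17 * tileCell ψ i j c
  | dcellV b => 1 + b
  | sconn => 0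
  | beadV j b => 17 * clauseBead ψ j + 1 + b
  | bconnS j => 17 * clauseBead ψ j
  | tgad i j r code => gbase ψ (8 * (i * N ψ + j) + r) + code
  | landS j code => gbase ψ (8 * (V ψ * N ψ) + j) + code
  | orS q code => gbase ψ (8 * (V ψ * N ψ) + N ψ + q) + code

/-- The intermediate decoding: a chain vertex `17 k + off` (`off < 17`) or a gadget vertex
`gbase g + code` (`code < 64`). [folklore] -/
inductive Sem3
  | chain (k off : ℕ)
  | gad (g code : ℕ)
  deriving DecidableEq

/-- The intermediate form of a structured vertex. [folklore] -/
def toSem3 (ψ : CNF ℕ) : SSem → Sem3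
  | cellV i j c b => .chain (tileCell ψ i j c) (1 + b)
  | tconn i j c => .chain (tileCell ψ i j c) 0
  | dcellV b => .chain 0 (1 + b)
  | sconn => .chain 0 0
  | beadV j b => .chain (clauseBead ψ j) (1 + b)
  | bconnS j => .chain (clauseBead ψ j) 0
  | tgad i j r code => .gad (8 * (i * N ψ + j) + r) code
  | landS j code => .gad (8 * (V ψ * N ψ) + j) code
  | orS q code => .gad (8 * (V ψ * N ψ) + N ψ + q) code

/-- The number of an intermediate form. [folklore] -/
def enc3 (ψ : CNF ℕ) : Sem3 → ℕ
  | .chain k off => 17 * k + off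
  | .gad g code => gbase ψ g + code

/-- `encS` factors through the intermediate form. [folklore] -/
theorem encS_eq_enc3 (s : SSem) : encS ψ s = enc3 ψ (toSem3 ψ s) := by
  cases s <;> simp [encS, enc3, toSem3] <;> ring

/-- Bounds of an intermediate form: `k < ncells`, `off < 17`; `code < 64`. [folklore] -/
def Sem3.OK (ψ : CNF ℕ) : Sem3 → Prop
  | .chain k off => k < ncells ψ ∧ off < 17
  | .gad _ code => code < 64

/-- The intermediate form of a well-formed structured vertex is within bounds. [folklore] -/
theorem toSem3_ok {s : SSem} (hs : s.WF ψ) : (toSem3 ψ s).OK ψ := by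
  cases s with
  | cellV i j c b => obtain ⟨hi, hj, hc, hb⟩ := hs; exact ⟨tileCell_lt_ncells ψ hi hj (by omega), by omega⟩
  | tconn i j c => obtain ⟨hi, hj, hc⟩ := hs; exact ⟨tileCell_lt_ncells ψ hi hj (by omega), by norm_num⟩
  | dcellV b => have hb : b < 16 := hs; exact ⟨by unfold ncells; omega, by show 1 + b < 17; omega⟩
  | sconn => exact ⟨by unfold ncells; omega, by norm_num⟩
  | beadV j b => obtain ⟨hj, hb⟩ := hs; exact ⟨clauseBead_lt_ncells ψ hj, by omega⟩
  | bconnS j => exact ⟨clauseBead_lt_ncells ψ hs, by norm_num⟩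
  | tgad i j r code => exact hs.2.2.2
  | landS j code => exact hs.2
  | orS q code => exact hs

/-- **`enc3` is injective** on forms within bounds. [folklore] -/
theorem enc3_inj {a b : Sem3} (ha : a.OK ψ) (hb : b.OK ψ) (h : enc3 ψ a = enc3 ψ b) : a = b := by
  cases a with
  | chain k off =>
    cases b with
    | chain k' off' =>
      simp only [enc3] at h
      obtain ⟨-, ho⟩ := ha; obtain ⟨-, ho'⟩ := hb
      have hk : k = k' := by omega
      subst hk
      have : off = off' := by omega
      rw [this]
    | gad g code =>
      exfalso
      simp only [enc3] at h
      obtain ⟨hk, ho⟩ := ha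
      unfold gbase at h
      nlinarith
  | gad g code =>
    cases b with
    | chain k off =>
      exfalso
      simp only [enc3] at h
      obtain ⟨hk, ho⟩ := hb
      unfold gbase at h
      nlinarith
    | gad g' code' =>
      simp only [enc3] at h
      unfold gbase at h
      have hc : code < 64 := ha
      have hc' : code' < 64 := hb
      have hg : g = g' := by omega
      subst hg
      have : code = code' := by omega
      rw [this]

/-- **The structured vertex of an intermediate form** (a left inverse of `toSem3`). [folklore] -/
def ofSem3 (ψ : CNF ℕ) : Sem3 → SSem
  | .chain k off =>
    if k = 0 then (if off = 0 then .sconn else .dcellV (off - 1))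
    else if k < 1 + 3 * (V ψ * N ψ) then
      (if off = 0 then .tconn ((k - 1) / 3 / N ψ) ((k - 1) / 3 % N ψ) ((k - 1) % 3)
       else .cellV ((k - 1) / 3 / N ψ) ((k - 1) / 3 % N ψ) ((k - 1) % 3) (off - 1))
    else (if off = 0 then .bconnS (k - (1 + 3 * (V ψ * N ψ))) else .beadV (k - (1 + 3 * (V ψ * N ψ))) (off - 1))
  | .gad g code =>
    if g < 8 * (V ψ * N ψ) then .tgad (g / 8 / N ψ) (g / 8 % N ψ) (g % 8) code
    else if g < 8 * (V ψ * N ψ) + N ψ then .landS (g - 8 * (V ψ * N ψ)) code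
    else .orS (g - 8 * (V ψ * N ψ) - N ψ) code

/-- Decomposing a gadget index of a tile. [folklore] -/
theorem gad_arith {i j r : ℕ} (hj : j < N ψ) (hr : r < 8) :
    (8 * (i * N ψ + j) + r) / 8 / N ψ = i ∧ (8 * (i * N ψ + j) + r) / 8 % N ψ = j ∧ (8 * (i * N ψ + j) + r) % 8 = r := by
  have hN : 0 < N ψ := by omega
  have h1 : (8 * (i * N ψ + j) + r) / 8 = i * N ψ + j := by omega
  refine ⟨?_, ?_, by omega⟩
  · rw [h1, Nat.add_div hN, Nat.mul_div_cancel _ hN, Nat.div_eq_of_lt hj]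
    simp [Nat.mod_eq_of_lt hj, show ¬ N ψ ≤ j from not_le.2 hj]
  · rw [h1, Nat.add_mod, Nat.mul_mod_left, zero_add, Nat.mod_mod, Nat.mod_eq_of_lt hj]

/-- A tile gadget index is below `8 V N`. [folklore] -/
theorem gad_lt {i j r : ℕ} (hi : i < V ψ) (hj : j < N ψ) (hr : r < 8) : 8 * (i * N ψ + j) + r < 8 * (V ψ * N ψ) := by
  have : i * N ψ + j < V ψ * N ψ := by
    calc i * N ψ + j < i * N ψ + N ψ := by omega
      _ = (i + 1) * N ψ := by ring
      _ ≤ V ψ * N ψ := Nat.mul_le_mul_right _ hi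
  omega

/-- **`ofSem3` inverts `toSem3` on well-formed structured vertices.** [folklore] -/
theorem ofSem3_toSem3 {s : SSem} (hs : s.WF ψ) : ofSem3 ψ (toSem3 ψ s) = s := by
  cases s with
  | cellV i j c b =>
    obtain ⟨hi, hj, hc, hb⟩ := hs
    obtain ⟨h1, h2, h3⟩ := tileCell_arith ψ (i := i) hj (show c < 3 by omega)
    have hpos := tileCell_pos ψ i j c
    have hlt := tileCell_lt ψ (c := c) hi hj (by omega)
    simp only [toSem3, ofSem3, if_neg hpos.ne', if_pos hlt, Nat.add_sub_cancel_left, h1, h2, h3,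
      show ¬ 1 + b = 0 by omega, ↓reduceIte]
  | tconn i j c =>
    obtain ⟨hi, hj, hc⟩ := hs
    obtain ⟨h1, h2, h3⟩ := tileCell_arith ψ (i := i) hj (show c < 3 by omega)
    have hpos := tileCell_pos ψ i j c
    have hlt := tileCell_lt ψ (c := c) hi hj (by omega)
    simp only [toSem3, ofSem3, if_neg hpos.ne', if_pos hlt, h1, h2, h3, ↓reduceIte]
  | dcellV b =>
    simp only [toSem3, ofSem3, ↓reduceIte, show ¬ 1 + b = 0 by omega, Nat.add_sub_cancel_left]
  | sconn => simp [toSem3, ofSem3]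
  | beadV j b =>
    obtain ⟨hj, hb⟩ := hs
    have h1 : ¬ clauseBead ψ j = 0 := by unfold clauseBead; omega
    have h2 : ¬ clauseBead ψ j < 1 + 3 * (V ψ * N ψ) := by unfold clauseBead; omega
    have h3 : clauseBead ψ j - (1 + 3 * (V ψ * N ψ)) = j := by unfold clauseBead; omega
    simp only [toSem3, ofSem3, if_neg h1, if_neg h2, show ¬ 1 + b = 0 by omega, ↓reduceIte, h3, Nat.add_sub_cancel_left]
  | bconnS j =>
    have h1 : ¬ clauseBead ψ j = 0 := by unfold clauseBead; omega
    have h2 : ¬ clauseBead ψ j < 1 + 3 * (V ψ * N ψ) := by unfold clauseBead; omega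
    have h3 : clauseBead ψ j - (1 + 3 * (V ψ * N ψ)) = j := by unfold clauseBead; omega
    simp only [toSem3, ofSem3, if_neg h1, if_neg h2, ↓reduceIte, h3]
  | tgad i j r code =>
    obtain ⟨hi, hj, hr, hc⟩ := hs
    obtain ⟨h1, h2, h3⟩ := gad_arith (i := i) hj hr
    simp only [toSem3, ofSem3, if_pos (gad_lt hi hj hr), h1, h2, h3]
  | landS j code =>
    obtain ⟨hj, hc⟩ := hs
    simp only [toSem3, ofSem3, show ¬ 8 * (V ψ * N ψ) + j < 8 * (V ψ * N ψ) by omega,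
      show 8 * (V ψ * N ψ) + j < 8 * (V ψ * N ψ) + N ψ by omega, ↓reduceIte, Nat.add_sub_cancel_left]
  | orS q code =>
    simp only [toSem3, ofSem3, show ¬ 8 * (V ψ * N ψ) + N ψ + q < 8 * (V ψ * N ψ) by omega,
      show ¬ 8 * (V ψ * N ψ) + N ψ + q < 8 * (V ψ * N ψ) + N ψ by omega, ↓reduceIte,
      show 8 * (V ψ * N ψ) + N ψ + q - 8 * (V ψ * N ψ) - N ψ = q by omega]

/-- **The numbering of well-formed structured vertices is injective.** [folklore] -/
theorem encS_injective {s s' : SSem} (hs : s.WF ψ) (hs' : s'.WF ψ) (h : encS ψ s = encS ψ s') : s = s' := by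
  rw [encS_eq_enc3, encS_eq_enc3] at h
  have h3 := enc3_inj (toSem3_ok hs) (toSem3_ok hs') h
  rw [← ofSem3_toSem3 hs, ← ofSem3_toSem3 hs', h3]

end SSem

/-! ### The structured vertex of a role -/

/-- **The structured vertex drawn by a role in matrix tile `(i, j)`** (connector `3` and the
next tile's row chord live in tile `(i, j+1)`; the column chord leaving lives in the tile below or
is the landing gadget). [folklore] -/
def ssemM (i j : ℕ) : TileRole → SSem
  | .cell c b => .cellV i j c b
  | .conn c => if c = 3 then .tconn i (j + 1) 0 else .tconn i j c
  | .gad r code => .tgad i j r code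
  | .gadNext0 code => .tgad i (j + 1) 0 code
  | .gadCo code => if i + 1 < V ψ then .tgad (i + 1) j 5 code else .landS j code
  | .dcell b => .dcellV b
  | _ => .sconn

/-- **The structured vertex drawn by a role in the clause-row column tile `j`.** [folklore] -/
def ssemC (j : ℕ) : TileRole → SSem
  | .bead b => .beadV j b
  | .bconn => .bconnS j
  | .bconnN => .bconnS (j + 1)
  | .land code => .landS j code
  | .orr i => .orS (colClause ψ j) (if isUnitCol ψ j then i else 6 * colInClause ψ j + i)
  | .orm => .orS (colClause ψ j) (if isUnitCol ψ j then 2 else 18 + colInClause ψ j)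
  | _ => .sconn

/-- **The structured vertex drawn by a role in the rung tile of clause `q`.** [folklore] -/
def ssemR (q : ℕ) : TileRole → SSem
  | .or code => .orS q code
  | _ => .sconn

/-- Connector `3` of tile `(i, j)` is connector `0` of tile `(i, j+1)`. [folklore] -/
theorem tileCell_three (i j : ℕ) : tileCell ψ i j 3 = tileCell ψ i (j + 1) 0 := by unfold tileCell; ring

/-- **The name of a matrix role is the number of its structured vertex** (for the roles a matrix
kind can have). [folklore] -/
theorem mName_eq_encS (i j : ℕ) (ρ : TileRole)
    (hρ : match ρ with | .cell _ _ | .conn _ | .gad _ _ | .gadNext0 _ | .gadCo _ | .dcell _ | .s => True | _ => False) :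
    mName ψ i j ρ = SSem.encS ψ (ssemM ψ i j ρ) := by
  cases ρ with
  | cell c b => rfl
  | conn c =>
    simp only [mName, ssemM]
    split_ifs with h
    · subst h; simp [SSem.encS, tileCell_three]
    · rfl
  | gad r code => rfl
  | gadNext0 code => simp [mName, ssemM, SSem.encS, Nat.add_assoc]
  | gadCo code =>
    simp only [mName, ssemM, colOwner]
    split_ifs <;> rfl
  | dcell b => rfl
  | s => rfl
  | _ => exact hρ.elim

/-- **The name of a clause role is the number of its structured vertex.** [folklore] -/
theorem cName_eq_encS (j : ℕ) (ρ : TileRole)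
    (hρ : match ρ with | .bead _ | .bconn | .bconnN | .land _ | .orr _ | .orm => True | _ => False) :
    cName ψ j ρ = SSem.encS ψ (ssemC ψ j ρ) := by
  cases ρ with
  | bead b => rfl
  | bconn => rfl
  | bconnN => rfl
  | land code => rfl
  | orr i => simp only [cName, ssemC, SSem.encS, orGadOf]
  | orm => simp only [cName, ssemC, SSem.encS, orGadOf]
  | _ => exact hρ.elim

/-- **The name of a rung role is the number of its structured vertex.** [folklore] -/
theorem rName_eq_encS (q : ℕ) (code : ℕ) : rName ψ q (.or code) = SSem.encS ψ (ssemR q (.or code)) := rfl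

/-! ### The names of the placements -/

/-- The names of a matrix placement. [folklore] -/
theorem matrixP_ν (i j idx : ℕ) : (matrixP ψ i j).ν idx = mName ψ i j ((mKind ψ i j).role idx) := rfl

/-- The names of a clause placement. [folklore] -/
theorem clauseP_ν (j idx : ℕ) : (clauseP ψ j).ν idx = cName ψ j ((cKind ψ j).role idx) := rfl

/-- The names of a rung placement. [folklore] -/
theorem rungP_ν (q idx : ℕ) : (rungP ψ q).ν idx = rName ψ q (Kind.rung3.role idx) := rfl

/-- The tile of a matrix placement. [folklore] -/
theorem matrixP_T (i j : ℕ) : (matrixP ψ i j).T = (mKind ψ i j).tile := rfl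

/-- The tile of a clause placement. [folklore] -/
theorem clauseP_T (j : ℕ) : (clauseP ψ j).T = (cKind ψ j).tile := rfl

/-- The tile of a rung placement. [folklore] -/
theorem rungP_T (q : ℕ) : (rungP ψ q).T = Kind.rung3.tile := rfl

/-! ### Unpacking `RoleAtOK` -/

namespace Kind

/-- The class part of `RoleAtOK` for a matrix kind: only matrix roles occur, with the stated
constraints. [folklore] -/
theorem matrix_role_cases (K : Kind) (hM : K.isMatrix = true) {idx : ℕ} (hidx : idx < K.tile.nv) :
    (∃ c b, K.role idx = .cell c b ∧ c ≤ 2 ∧ b < 16 ∧ (K.isLastCol = true → c = 2 → b = 3 → K.posAt idx = (72, 26))) ∨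
    (∃ c, K.role idx = .conn c ∧ ((c ≤ 2 ∧ (c = 0 → K.isDoubler = false → K.posAt idx = (0, 14))) ∨
      (c = 3 ∧ K.isLastCol = false ∧ K.posAt idx = (72, 14)))) ∨
    (∃ r code, K.role idx = .gad r code ∧ ((1 ≤ r ∧ r ≤ 4 ∧ code < 12) ∨
      (r = 0 ∧ K.isFirstCol = false ∧ ((code = 4 ∧ K.posAt idx = (0, 20)) ∨ (code = 7 ∧ K.posAt idx = (0, 28)))) ∨
      (r = 5 ∧ K.isCross = true ∧ ((code = 4 ∧ K.posAt idx = (40, 54)) ∨ (code = 7 ∧ K.posAt idx = (46, 54)))))) ∨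
    (∃ code, K.role idx = .gadNext0 code ∧ K.isLastCol = false ∧ code < 12 ∧
      (code = 4 → K.posAt idx = (72, 20)) ∧ (code = 7 → K.posAt idx = (72, 28))) ∨
    (∃ code, K.role idx = .gadCo code ∧ K.hasCo = true ∧ code < 12 ∧
      (code = 4 → K.posAt idx = (40, 0)) ∧ (code = 7 → K.posAt idx = (46, 0))) ∨
    (∃ b, K.role idx = .dcell b ∧ K.isDoubler = true ∧ b < 12) ∨
    (K.role idx = .s ∧ K.isDoubler = true) := by
  have h := K.roleAtOK hidx
  unfold RoleAtOK at h
  simp only [Bool.and_eq_true] at h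
  obtain ⟨⟨⟨⟨h, -⟩, -⟩, -⟩, -⟩ := h
  generalize hρ : K.role idx = ρ at h
  have hC : K.isClause = false := by cases K <;> simp_all [isMatrix, isClause]
  have hR : K ≠ .rung3 := by rintro rfl; simp [isMatrix] at hM
  cases ρ with
  | cell c b =>
    left
    simp only [Bool.and_eq_true, Bool.or_eq_true, Bool.not_eq_true', Bool.and_eq_false_iff, decide_eq_true_eq,
      decide_eq_false_iff_not] at h
    obtain ⟨⟨⟨-, hc⟩, hb⟩, hp⟩ := h
    refine ⟨c, b, rfl, hc, hb, fun hl h2 h3 => ?_⟩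
    rcases hp with hp | hp
    · exfalso; rw [hl] at hp; simp [h2, h3] at hp
    · exact hp
  | conn c =>
    right; left; refine ⟨c, rfl, ?_⟩
    simp only [Bool.and_eq_true, Bool.or_eq_true, decide_eq_true_eq, Bool.not_eq_true'] at h
    cases h.2 with
    | inl h =>
      refine Or.inl ⟨h.1, fun h0 hd => ?_⟩
      rcases h.2 with (hne | hd') | hp
      · exact absurd h0 hne
      · rw [hd] at hd'; exact absurd hd' (by simp)
      · exact hp
    | inr h => exact Or.inr ⟨h.1.1, h.1.2, h.2⟩
  | gad r code =>
    right; right; left; refine ⟨r, code, rfl, ?_⟩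
    simp only [Bool.and_eq_true, Bool.or_eq_true, decide_eq_true_eq, Bool.not_eq_true'] at h
    cases h.2 with
    | inl h =>
      cases h with
      | inl h => exact Or.inl ⟨h.1.1, h.1.2, h.2⟩
      | inr h =>
        refine Or.inr (Or.inl ⟨h.1.1, h.1.2, ?_⟩)
        cases h.2 with
        | inl h => exact Or.inl ⟨h.1, h.2⟩
        | inr h => exact Or.inr ⟨h.1, h.2⟩
    | inr h =>
      refine Or.inr (Or.inr ⟨h.1.1, h.1.2, ?_⟩)
      cases h.2 with
      | inl h => exact Or.inl ⟨h.1, h.2⟩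
      | inr h => exact Or.inr ⟨h.1, h.2⟩
  | gadNext0 code =>
    right; right; right; left; refine ⟨code, rfl, ?_⟩
    simp only [Bool.and_eq_true, Bool.or_eq_true, decide_eq_true_eq, Bool.not_eq_true'] at h
    obtain ⟨⟨⟨⟨-, hl⟩, hc⟩, h4⟩, h7⟩ := h
    exact ⟨hl, hc, fun h => (h4.resolve_left (by simp [h])), fun h => (h7.resolve_left (by simp [h]))⟩
  | gadCo code =>
    right; right; right; right; left; refine ⟨code, rfl, ?_⟩
    simp only [Bool.and_eq_true, Bool.or_eq_true, decide_eq_true_eq] at h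
    obtain ⟨⟨⟨⟨-, hco⟩, hc⟩, h4⟩, h7⟩ := h
    exact ⟨hco, hc, fun h => (h4.resolve_left (by simp [h])), fun h => (h7.resolve_left (by simp [h]))⟩
  | dcell b =>
    right; right; right; right; right; left
    simp only [Bool.and_eq_true, decide_eq_true_eq] at h
    exact ⟨b, rfl, h.1, h.2⟩
  | s => right; right; right; right; right; right; exact ⟨rfl, h⟩
  | bead b => simp only [Bool.and_eq_true, hC, Bool.false_eq_true, false_and] at h
  | bconn => simp only [Bool.and_eq_true, hC, Bool.false_eq_true, false_and] at h
  | bconnN => simp only [Bool.and_eq_true, hC, Bool.false_eq_true, false_and] at h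
  | land code => simp only [Bool.and_eq_true, hC, Bool.false_eq_true, false_and] at h
  | orr i => simp only [Bool.and_eq_true, hC, Bool.false_eq_true, false_and] at h
  | orm => simp only [hC, Bool.false_eq_true] at h
  | or code => simp only [Bool.and_eq_true, decide_eq_true_eq] at h; exact absurd h.1.1.1 hR

/-- The class part of `RoleAtOK` for a clause kind. [folklore] -/
theorem clause_role_cases (K : Kind) (hC : K.isClause = true) {idx : ℕ} (hidx : idx < K.tile.nv) :
    (∃ b, K.role idx = .bead b ∧ b < 12) ∨
    (K.role idx = .bconn ∧ K.posAt idx = (0, 14)) ∨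
    (K.role idx = .bconnN ∧ K.isLastClause = false ∧ K.posAt idx = (72, 14)) ∨
    (∃ code, K.role idx = .land code ∧ ((code = 4 ∧ K.posAt idx = (40, 40)) ∨ (code = 7 ∧ K.posAt idx = (46, 40)))) ∨
    (∃ i, K.role idx = .orr i ∧ i < 6 ∧ (K.isUnitK = true → i < 2) ∧
      (K.isUnitK = false → (i = 0 ∨ i = 2 ∨ i = 3 ∨ i = 4) → K.posAt idx = (((34 + i : ℕ) : ℤ), 0))) ∨
    (K.role idx = .orm) := by
  have h := K.roleAtOK hidx
  unfold RoleAtOK at h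
  simp only [Bool.and_eq_true] at h
  obtain ⟨⟨⟨⟨h, -⟩, -⟩, -⟩, -⟩ := h
  generalize hρ : K.role idx = ρ at h
  have hM : K.isMatrix = false := (Kind.ne_rung_of_isClause hC).2
  have hR : K ≠ .rung3 := (Kind.ne_rung_of_isClause hC).1
  have hD : K.isDoubler = false := by cases K <;> simp_all [isClause, isDoubler]
  cases ρ with
  | cell c b => simp only [Bool.and_eq_true, hM, Bool.false_eq_true, false_and] at h
  | conn c => simp only [Bool.and_eq_true, hM, Bool.false_eq_true, false_and] at h
  | gad r code => simp only [Bool.and_eq_true, hM, Bool.false_eq_true, false_and] at h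
  | gadNext0 code => simp only [Bool.and_eq_true, hM, Bool.false_eq_true, false_and] at h
  | gadCo code => simp only [Bool.and_eq_true, hM, Bool.false_eq_true, false_and] at h
  | dcell b => simp only [Bool.and_eq_true, hD, Bool.false_eq_true, false_and] at h
  | s => simp only [hD, Bool.false_eq_true] at h
  | bead b => left; simp only [Bool.and_eq_true, decide_eq_true_eq] at h; exact ⟨b, rfl, h.2⟩
  | bconn => right; left; simp only [Bool.and_eq_true, decide_eq_true_eq] at h; exact ⟨rfl, h.2⟩
  | bconnN =>
    right; right; left
    simp only [Bool.and_eq_true, decide_eq_true_eq, Bool.not_eq_true'] at h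
    exact ⟨rfl, h.1.2, h.2⟩
  | land code =>
    right; right; right; left; refine ⟨code, rfl, ?_⟩
    simp only [Bool.and_eq_true, Bool.or_eq_true, decide_eq_true_eq] at h
    cases h.2 with
    | inl h => exact Or.inl ⟨h.1, h.2⟩
    | inr h => exact Or.inr ⟨h.1, h.2⟩
  | orr i =>
    right; right; right; right; left; refine ⟨i, rfl, ?_⟩
    simp only [Bool.and_eq_true, Bool.or_eq_true, decide_eq_true_eq, Bool.not_eq_true'] at h
    obtain ⟨⟨⟨-, hi⟩, hu⟩, hp⟩ := h
    refine ⟨hi, fun hU => ?_, fun hU hi0 => ?_⟩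
    · rcases hu with hu | hu
      · rw [hU] at hu; exact absurd hu (by simp)
      · exact hu
    · rcases hp with (hp | hp) | hp
      · rw [hU] at hp; exact absurd hp (by simp)
      · simp only [Bool.or_eq_false_iff, decide_eq_false_iff_not] at hp
        omega
      · exact hp
  | orm => right; right; right; right; right; rfl
  | or code => simp only [Bool.and_eq_true, decide_eq_true_eq] at h; exact absurd h.1.1.1 hR

/-- The class part of `RoleAtOK` for the rung kind. [folklore] -/
theorem rung_role_cases {idx : ℕ} (hidx : idx < Kind.rung3.tile.nv) :
    ∃ code, Kind.rung3.role idx = .or code ∧ code < 27 ∧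
      (code < 18 → (code % 6 = 0 ∨ code % 6 = 2 ∨ code % 6 = 3 ∨ code % 6 = 4) ∧
        Kind.rung3.posAt idx = (((72 * (code / 6) + 34 + code % 6 : ℕ) : ℤ), 8)) ∧
      (18 ≤ code → 21 ≤ code) := by
  have h := Kind.rung3.roleAtOK hidx
  unfold RoleAtOK at h
  simp only [Bool.and_eq_true] at h
  obtain ⟨⟨⟨⟨h, -⟩, -⟩, -⟩, -⟩ := h
  generalize hρ : Kind.rung3.role idx = ρ at h
  cases ρ with
  | or code =>
    refine ⟨code, rfl, ?_⟩
    simp only [Bool.and_eq_true, Bool.or_eq_true, decide_eq_true_eq] at h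
    obtain ⟨⟨⟨-, hc⟩, h1⟩, h2⟩ := h
    refine ⟨hc, fun hlt => ?_, fun hge => ?_⟩
    · cases h1 with
      | inl h1 => omega
      | inr h1 => exact ⟨by rcases h1.1 with ((h | h) | h) | h <;> simp [h], h1.2⟩
    · rcases h2 with h2 | h2
      · omega
      · exact h2
  | _ => simp [isMatrix, isClause, isDoubler] at h

end Kind

/-! ### Well-formedness of the structured vertices of placed roles -/

/-- Crossing tiles are below their variable's row: `1 ≤ i`. [folklore] -/
theorem one_le_of_cross {i j : ℕ} (h : tileTy ψ i j = .cross) : 1 ≤ i := by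
  have := (tileTy_eq_cross_iff ψ).1 h; omega

/-- **The structured vertex of a role of a placed matrix tile is well formed.** [folklore] -/
theorem ssemM_wf {i j : ℕ} (hi : i < V ψ) (hj : j < N ψ) {idx : ℕ} (hidx : idx < (mKind ψ i j).tile.nv) :
    (ssemM ψ i j ((mKind ψ i j).role idx)).WF ψ := by
  have hcases := (mKind ψ i j).matrix_role_cases (mKind_isMatrix ψ i j) hidx
  have hlast := mKind_isLastCol ψ i j
  rcases hcases with ⟨c, b, hρ, hc, hb⟩ | ⟨c, hρ, hc⟩ | ⟨r, code, hρ, hr⟩ | ⟨code, hρ, hl, hc, -⟩ | ⟨code, hρ, hco, hc, -⟩ |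
    ⟨b, hρ, hd, hb⟩ | ⟨hρ, hd⟩
  · rw [hρ]; exact ⟨hi, hj, hc, hb.1⟩
  · rw [hρ]; simp only [ssemM]
    rcases hc with ⟨hc, -⟩ | ⟨rfl, hl, -⟩
    · rw [if_neg (by omega)]; exact ⟨hi, hj, hc⟩
    · rw [if_pos rfl]
      rw [hlast] at hl
      simp only [decide_eq_false_iff_not] at hl
      exact ⟨hi, by omega, by norm_num⟩
  · rw [hρ]
    rcases hr with ⟨-, hr4, hc⟩ | ⟨rfl, -, hc⟩ | ⟨rfl, -, hc⟩
    · exact ⟨hi, hj, by omega, by omega⟩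
    · exact ⟨hi, hj, by norm_num, by rcases hc with ⟨rfl, -⟩ | ⟨rfl, -⟩ <;> norm_num⟩
    · exact ⟨hi, hj, by norm_num, by rcases hc with ⟨rfl, -⟩ | ⟨rfl, -⟩ <;> norm_num⟩
  · rw [hρ]
    rw [hlast] at hl
    simp only [decide_eq_false_iff_not] at hl
    exact ⟨hi, by omega, by norm_num, by omega⟩
  · rw [hρ]; simp only [ssemM]
    split_ifs with h
    · exact ⟨h, hj, by norm_num, by omega⟩
    · exact ⟨hj, by omega⟩
  · rw [hρ]; exact show b < 16 by omega
  · rw [hρ]; trivial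

/-- **The structured vertex of a role of a placed clause tile is well formed** (clause widths at
most three, as in the normal form). [folklore] -/
theorem ssemC_wf (hw : ∀ q (hq : q < ψ.length), ψ[q].length ≤ 3) {j : ℕ} (hj : j < N ψ) {idx : ℕ}
    (hidx : idx < (cKind ψ j).tile.nv) : (ssemC ψ j ((cKind ψ j).role idx)).WF ψ := by
  have hcases := (cKind ψ j).clause_role_cases (cKind_isClause ψ j) hidx
  obtain ⟨hq, hm, hjq⟩ := colClause_spec ψ hj
  have hm3 : colInClause ψ j < 3 := by
    rw [getD_map_length' ψ hq] at hm
    exact lt_of_lt_of_le hm (hw _ hq)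
  rcases hcases with ⟨b, hρ, hb⟩ | ⟨hρ, -⟩ | ⟨hρ, hl, -⟩ | ⟨code, hρ, hc⟩ | ⟨i, hρ, hi, -, -⟩ | hρ
  · rw [hρ]; exact ⟨hj, by omega⟩
  · rw [hρ]; exact hj
  · rw [hρ]
    rw [cKind_isLastClause] at hl
    simp only [decide_eq_false_iff_not] at hl
    exact show j + 1 < N ψ by omega
  · rw [hρ]; exact ⟨hj, by rcases hc with ⟨rfl, -⟩ | ⟨rfl, -⟩ <;> norm_num⟩
  · rw [hρ]
    show (if isUnitCol ψ j = true then i else 6 * colInClause ψ j + i) < 64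
    split_ifs <;> omega
  · rw [hρ]
    show (if isUnitCol ψ j = true then 2 else 18 + colInClause ψ j) < 64
    split_ifs <;> omega

/-- **The structured vertex of a role of a placed rung tile is well formed.** [folklore] -/
theorem ssemR_wf {q : ℕ} {idx : ℕ} (hidx : idx < Kind.rung3.tile.nv) : (ssemR q (Kind.rung3.role idx)).WF ψ := by
  obtain ⟨code, hρ, hc, -⟩ := Kind.rung_role_cases hidx
  rw [hρ]; exact show code < 64 by omega

end FormulaTiles

end Literature.Barriers.CriticalPhenomena.GridSAW

/-!
# The tiling of the grid drawing of the graph of a formula, V: positions of names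

The geometric half of "equal names ⇒ equal positions" for the placements of
`GridSAWFormulaTiling.lean` (the grid drawing `E₀` of `GridFormula.graphOf ψ`;
Liśkiewicz–Ogihara–Toda 2003, Lemma 4 / Theorem 7, tree fact `GridSAW.LOT2003_lemma4_gadgets`):
every structured vertex (`SSem`, `GridSAWFormulaTilingNames.lean`) has a CANONICAL position
`posS` (the origin of its home tile plus the position of its home role), and every placed tile
draws each of its local vertices at the canonical position of the structured vertex it names
(`placed_matrix`, `placed_clause`, `placed_rung`): for the tile's own vertices this is the
definition, for the vertices it shares from a neighbour (connector `3`, the row chord's far rail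
nodes, the column chord's far rail nodes, the next terminal's connector, the rung tile's rail
nodes) it is the agreement of the interface positions recorded in `RoleAtOK`. Consequences:

* **`pos_eq_of_ν_eq`** — two placed vertices with the same name are at the same point;
* **`gposOf_eq`** — the position function of the drawing (first placement listing the name)
  agrees with every placement (`TilingHypsGeo.pos_eq`).

## References

* M. Liśkiewicz, M. Ogihara, S. Toda, TCS 304 (2003) 129–156, §4 (proof of Theorem 7, `E₀`).
-/

namespace Literature.Barriers.CriticalPhenomena.GridSAW

/-- Translation is addition of the origin. [folklore] -/
theorem Placement.shift_eq_add (P : Placement) (p : GridPoint) : P.shift p = P.o + p := rfl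

namespace FormulaTiles

open Literature.Computability.Complexity (CNF)
open Literature.Combinatorics.SimpleGraph Literature.Combinatorics.SimpleGraph.GridFormula
open Literature.Combinatorics.SimpleGraph.GridFormula.Slot

/-! ### The position of a role in a kind -/

namespace Kind

/-- **The position of a role in a kind** (junk if absent). [folklore] -/
def posOfRole (K : Kind) (ρ : TileRole) : GridPoint := K.posAt (K.roles.idxOf ρ)

/-- The position of the role of a local vertex is the position of that vertex. [folklore] -/
theorem posOfRole_eq_of_role (K : Kind) {idx : ℕ} (hidx : idx < K.tile.nv) {ρ : TileRole} (h : K.role idx = ρ) :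
    K.posOfRole ρ = K.tile.pos[idx] := by
  unfold posOfRole
  rw [← h, K.role_eq_getElem hidx, K.roles_nodup.idxOf_getElem, K.posAt_eq_getElem hidx]

/-- **A listed role determines its position**: if some local vertex `idx` has role `ρ` and the
facts force `posAt idx = p`, then `posOfRole ρ = p`. [folklore] -/
theorem posOfRole_eq_of_forall (K : Kind) {ρ : TileRole} (hρ : ρ ∈ K.roles) {p : GridPoint}
    (h : ∀ idx < K.tile.nv, K.role idx = ρ → K.posAt idx = p) : K.posOfRole ρ = p := by
  obtain ⟨idx, hidx, hr⟩ := K.exists_idx_of_mem_roles hρ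
  rw [K.posOfRole_eq_of_role hidx hr, ← K.posAt_eq_getElem hidx, h idx hidx hr]

end Kind

variable (ψ : CNF ℕ)

/-! ### Origins -/

/-- The origin of matrix tile `(i, j)`. [folklore] -/
def oM (i j : ℕ) : GridPoint := (((72 * j : ℕ) : ℤ), -((54 * (i + 1) : ℕ) : ℤ))

/-- The origin of the clause-row column tile `j`. [folklore] -/
def oC (j : ℕ) : GridPoint := (((72 * j : ℕ) : ℤ), yClause ψ)

/-- The origin of the rung tile of clause `q`. [folklore] -/
def oR (q : ℕ) : GridPoint := (((72 * cstart ψ q : ℕ) : ℤ), yClause ψ - 8)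

/-- The origin of a matrix placement. [folklore] -/
theorem matrixP_o (i j : ℕ) : (matrixP ψ i j).o = oM i j := rfl

/-- The origin of a clause placement. [folklore] -/
theorem clauseP_o (j : ℕ) : (clauseP ψ j).o = oC ψ j := rfl

/-- The origin of a rung placement. [folklore] -/
theorem rungP_o (q : ℕ) : (rungP ψ q).o = oR ψ q := rfl

/-! ### The canonical position of a structured vertex -/

/-- **The canonical position of a structured vertex**: origin of the home tile plus position of
the home role. [folklore] -/
def posS : SSem → GridPoint
  | .cellV i j c b => oM i j + (mKind ψ i j).posOfRole (.cell c b)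
  | .tconn i j c => oM i j + (mKind ψ i j).posOfRole (.conn c)
  | .dcellV b => oM 0 0 + (mKind ψ 0 0).posOfRole (.dcell b)
  | .sconn => oM 0 0 + (mKind ψ 0 0).posOfRole .s
  | .beadV j b => oC ψ j + (cKind ψ j).posOfRole (.bead b)
  | .bconnS j => oC ψ j + (cKind ψ j).posOfRole .bconn
  | .tgad i j r code =>
    if 1 ≤ r ∧ r ≤ 4 then oM i j + (mKind ψ i j).posOfRole (.gad r code)
    else if r = 0 then oM i (j - 1) + (mKind ψ i (j - 1)).posOfRole (.gadNext0 code)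
    else oM (i - 1) j + (mKind ψ (i - 1) j).posOfRole (.gadCo code)
  | .landS j code => oM (V ψ - 1) j + (mKind ψ (V ψ - 1) j).posOfRole (.gadCo code)
  | .orS q code =>
    if (ψ.map List.length).getD q 0 = 1 then
      oC ψ (cstart ψ q) + (cKind ψ (cstart ψ q)).posOfRole (if code < 2 then .orr code else .orm)
    else if code < 18 then oC ψ (cstart ψ q + code / 6) + (cKind ψ (cstart ψ q + code / 6)).posOfRole (.orr (code % 6))
    else if code < 21 then oC ψ (cstart ψ q + (code - 18)) + (cKind ψ (cstart ψ q + (code - 18))).posOfRole .orm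
    else oR ψ q + Kind.rung3.posOfRole (.or code)

/-! ### Positions of interface roles in neighbouring kinds -/

/-- In a non-doubler matrix kind, connector `0` sits at `(0, 14)`. [folklore] -/
theorem posOfRole_conn0 {K : Kind} (hM : K.isMatrix = true) (hD : K.isDoubler = false) : K.posOfRole (.conn 0) = (0, 14) := by
  refine K.posOfRole_eq_of_forall ((K.mem_roles_iff).2 ?_) fun idx hidx hr => ?_
  · unfold Kind.expectedRoles; simp [hM]
  · rcases K.matrix_role_cases hM hidx with ⟨c, b, h, -⟩ | ⟨c, h, hc⟩ | ⟨r, code, h, -⟩ | ⟨code, h, -⟩ | ⟨code, h, -⟩ | ⟨b, h, -⟩ | ⟨h, -⟩ <;>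
      rw [hr] at h <;> simp only [reduceCtorEq, TileRole.conn.injEq] at h
    subst h
    rcases hc with ⟨-, h0⟩ | ⟨h3, -⟩
    · exact h0 rfl hD
    · exact absurd h3 (by norm_num)

/-- In a non-last matrix kind, the next row chord's rail-1 end nodes sit at `(72, 20)`, `(72, 28)`. [folklore] -/
theorem posOfRole_gadNext0 {K : Kind} (hM : K.isMatrix = true) (hL : K.isLastCol = false) {code : ℕ} (hc : code = 4 ∨ code = 7) :
    K.posOfRole (.gadNext0 code) = (72, if code = 4 then 20 else 28) := by
  refine K.posOfRole_eq_of_forall ((K.mem_roles_iff).2 ?_) fun idx hidx hr => ?_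
  · unfold Kind.expectedRoles; simp [hM, hL]; omega
  · rcases K.matrix_role_cases hM hidx with ⟨c, b, h, -⟩ | ⟨c, h, -⟩ | ⟨r, code, h, -⟩ | ⟨code', h, -, -, h4, h7⟩ | ⟨code, h, -⟩ | ⟨b, h, -⟩ | ⟨h, -⟩ <;>
      rw [hr] at h <;> simp only [reduceCtorEq, TileRole.gadNext0.injEq] at h
    subst h
    rcases hc with rfl | rfl
    · simpa using h4 rfl
    · simpa using h7 rfl

/-- In a matrix kind with a column chord leaving, its rail-1 end nodes sit at `(40, 0)`, `(46, 0)`. [folklore] -/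
theorem posOfRole_gadCo {K : Kind} (hM : K.isMatrix = true) (hco : K.hasCo = true) {code : ℕ} (hc : code = 4 ∨ code = 7) :
    K.posOfRole (.gadCo code) = (if code = 4 then 40 else 46, 0) := by
  refine K.posOfRole_eq_of_forall ((K.mem_roles_iff).2 ?_) fun idx hidx hr => ?_
  · unfold Kind.expectedRoles; simp [hM, hco]; omega
  · rcases K.matrix_role_cases hM hidx with ⟨c, b, h, -⟩ | ⟨c, h, -⟩ | ⟨r, code, h, -⟩ | ⟨code', h, -⟩ | ⟨code', h, -, -, h4, h7⟩ | ⟨b, h, -⟩ | ⟨h, -⟩ <;>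
      rw [hr] at h <;> simp only [reduceCtorEq, TileRole.gadCo.injEq] at h
    subst h
    rcases hc with rfl | rfl
    · simpa using h4 rfl
    · simpa using h7 rfl

/-- In a clause kind, the connector sits at `(0, 14)`. [folklore] -/
theorem posOfRole_bconn {K : Kind} (hC : K.isClause = true) : K.posOfRole .bconn = (0, 14) := by
  refine K.posOfRole_eq_of_forall ((K.mem_roles_iff).2 ?_) fun idx hidx hr => ?_
  · unfold Kind.expectedRoles; simp [hC, (Kind.ne_rung_of_isClause hC).2]
  · rcases K.clause_role_cases hC hidx with ⟨b, h, -⟩ | ⟨-, hp⟩ | ⟨h, -⟩ | ⟨code, h, -⟩ | ⟨i, h, -⟩ | h <;>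
      first | exact hp | (rw [hr] at h; simp at h)

/-- In a three-literal clause kind, rail node `i ∈ {0,2,3,4}` of its OR-rail sits at `(34 + i, 0)`. [folklore] -/
theorem posOfRole_orr {K : Kind} (hC : K.isClause = true) (hU : K.isUnitK = false) {i : ℕ} (hi : i = 0 ∨ i = 2 ∨ i = 3 ∨ i = 4) :
    K.posOfRole (.orr i) = (((34 + i : ℕ) : ℤ), 0) := by
  refine K.posOfRole_eq_of_forall ((K.mem_roles_iff).2 ?_) fun idx hidx hr => ?_
  · unfold Kind.expectedRoles; simp [hC, (Kind.ne_rung_of_isClause hC).2, hU]; omega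
  · rcases K.clause_role_cases hC hidx with ⟨b, h, -⟩ | ⟨h, -⟩ | ⟨h, -⟩ | ⟨code, h, -⟩ | ⟨i', h, -, -, hp⟩ | h <;>
      rw [hr] at h <;> simp only [reduceCtorEq, TileRole.orr.injEq] at h
    subst h
    exact hp hU hi

/-! ### Helpers on the layout -/

/-- A placed tile whose kind is not a first-column kind is not in column `0`. [folklore] -/
theorem one_le_col_of_not_firstCol {i j : ℕ} (hi : i < V ψ) (hj : j < N ψ) (h : (mKind ψ i j).isFirstCol = false) : 1 ≤ j := by
  by_contra hj0
  obtain rfl : j = 0 := by omega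
  by_cases hi0 : i = 0
  · subst hi0
    have hd := mKind_isDoubler ψ 0 0
    simp only [and_self, decide_true] at hd
    revert h hd; cases mKind ψ 0 0 <;> simp [Kind.isFirstCol, Kind.isDoubler]
  · have hV := V_le_N ψ
    have hf := mKind_isFirstCol ψ i 0 (Or.inl (by omega))
    rw [h] at hf
    simp at hf

/-- A crossing kind sits at `(i, j)` with `1 ≤ i`, and the tile above has a column chord leaving. [folklore] -/
theorem cross_above {i j : ℕ} (h : (mKind ψ i j).isCross = true) : 1 ≤ i ∧ (mKind ψ (i - 1) j).hasCo = true := by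
  have h00 : ¬ (i = 0 ∧ j = 0) := by
    rintro ⟨rfl, rfl⟩
    have hd := mKind_isDoubler ψ 0 0
    simp only [and_self, decide_true] at hd
    revert h hd; cases mKind ψ 0 0 <;> simp [Kind.isCross, Kind.isDoubler]
  rw [mKind_isCross ψ i j h00, decide_eq_true_eq] at h
  have hrow := (tileTy_eq_cross_iff ψ).1 h
  refine ⟨by omega, ?_⟩
  by_cases h0 : i - 1 = 0 ∧ j = 0
  · rw [h0.1, h0.2]; exact mKind_hasCo_zero ψ
  · rw [mKind_hasCo ψ _ _ h0]
    have : tileTy ψ (i - 1) j ≠ .empty := by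
      rw [Ne, tileTy_eq_empty_iff]; omega
    simp [this]

/-- The tile in the last row of a column has a column chord leaving (or is the doubler). [folklore] -/
theorem lastRow_hasCo {j : ℕ} (hj : j < N ψ) : (mKind ψ (V ψ - 1) j).hasCo = true := by
  by_cases h0 : V ψ - 1 = 0 ∧ j = 0
  · rw [h0.1, h0.2]; exact mKind_hasCo_zero ψ
  · rw [mKind_hasCo ψ _ _ h0]
    have := rowOf_varOf_lt ψ hj
    have : tileTy ψ (V ψ - 1) j ≠ .empty := by rw [Ne, tileTy_eq_empty_iff]; omega
    simp [this]

/-- Arithmetic of the origins: one column east. [folklore] -/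
theorem oM_col_succ (i j : ℕ) : oM i (j + 1) = oM i j + ((72 : ℤ), (0 : ℤ)) := by
  refine Prod.ext ?_ ?_ <;> (simp only [oM, Prod.fst_add, Prod.snd_add]; omega)

/-- Arithmetic of the origins: one row up. [folklore] -/
theorem oM_row_pred {i : ℕ} (hi : 1 ≤ i) (j : ℕ) : oM (i - 1) j + ((0 : ℤ), (-54 : ℤ)) = oM i j := by
  refine Prod.ext ?_ ?_ <;> (simp only [oM, Prod.fst_add, Prod.snd_add]; omega)

/-- Arithmetic of the origins: the clause row below the last matrix row. [folklore] -/
theorem oM_lastRow (hV : 1 ≤ V ψ) (j : ℕ) : oM (V ψ - 1) j = oC ψ j + ((0 : ℤ), (40 : ℤ)) := by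
  refine Prod.ext ?_ ?_ <;> (simp only [oM, oC, yClause_eq, Prod.fst_add, Prod.snd_add]; omega)

/-- Arithmetic of the origins: one clause column east. [folklore] -/
theorem oC_succ (j : ℕ) : oC ψ (j + 1) = oC ψ j + ((72 : ℤ), (0 : ℤ)) := by
  refine Prod.ext ?_ ?_ <;> (simp only [oC, Prod.fst_add, Prod.snd_add]; omega)

/-- Arithmetic of the origins: the rung tile below the clause columns. [folklore] -/
theorem oR_add (q r : ℕ) : oR ψ q + (((72 * r : ℕ) : ℤ), (8 : ℤ)) = oC ψ (cstart ψ q + r) := by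
  refine Prod.ext ?_ ?_ <;> (simp only [oR, oC, Prod.fst_add, Prod.snd_add]; omega)

/-- `posS` of a gadget-`0` vertex: drawn by the west tile. [folklore] -/
theorem posS_tgad0 (i j code : ℕ) :
    posS ψ (.tgad i j 0 code) = oM i (j - 1) + (mKind ψ i (j - 1)).posOfRole (.gadNext0 code) := by
  simp [posS]

/-- `posS` of a gadget-`5` vertex: drawn by the tile above. [folklore] -/
theorem posS_tgad5 (i j code : ℕ) :
    posS ψ (.tgad i j 5 code) = oM (i - 1) j + (mKind ψ (i - 1) j).posOfRole (.gadCo code) := by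
  simp [posS]

/-- `posS` of a gadget-`r` vertex, `1 ≤ r ≤ 4`: at home. [folklore] -/
theorem posS_tgadR {r : ℕ} (h1 : 1 ≤ r) (h4 : r ≤ 4) (i j code : ℕ) :
    posS ψ (.tgad i j r code) = oM i j + (mKind ψ i j).posOfRole (.gad r code) := by
  simp [posS, h1, h4]

/-! ### Every placed vertex is drawn at the canonical position of the structured vertex it names -/

/-- **Matrix placements.** [folklore] -/
theorem placed_matrix {i j : ℕ} (hi : i < V ψ) (hj : j < N ψ) {idx : ℕ} (hidx : idx < (mKind ψ i j).tile.nv) :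
    (ssemM ψ i j ((mKind ψ i j).role idx)).WF ψ ∧
      (matrixP ψ i j).ν idx = SSem.encS ψ (ssemM ψ i j ((mKind ψ i j).role idx)) ∧
      (matrixP ψ i j).shift ((mKind ψ i j).tile.pos[idx]) = posS ψ (ssemM ψ i j ((mKind ψ i j).role idx)) := by
  set K := mKind ψ i j with hK
  have hM : K.isMatrix = true := mKind_isMatrix ψ i j
  refine ⟨ssemM_wf ψ hi hj hidx, ?_, ?_⟩
  · rw [matrixP_ν]
    refine mName_eq_encS ψ i j _ ?_
    rcases K.matrix_role_cases hM hidx with ⟨c, b, h, -⟩ | ⟨c, h, -⟩ | ⟨r, code, h, -⟩ | ⟨code, h, -⟩ | ⟨code, h, -⟩ | ⟨b, h, -⟩ | ⟨h, -⟩ <;>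
      rw [h] <;> trivial
  rw [Placement.shift_eq_add, matrixP_o]
  have hhome : ∀ {ρ : TileRole}, K.role idx = ρ → oM i j + K.posOfRole ρ = oM i j + K.tile.pos[idx] := fun h => by
    rw [K.posOfRole_eq_of_role hidx h]
  rcases K.matrix_role_cases hM hidx with ⟨c, b, h, -⟩ | ⟨c, h, hc⟩ | ⟨r, code, h, hr⟩ | ⟨code, h, hl, hc, -⟩ | ⟨code, h, hco, hc, -⟩ |
    ⟨b, h, hd, -⟩ | ⟨h, hd⟩
  · -- a cell vertex: home
    rw [h]; exact (hhome h).symm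
  · rw [h]; simp only [ssemM]
    rcases hc with ⟨hc, -⟩ | ⟨rfl, hl, hp⟩
    · rw [if_neg (show ¬ c = 3 by omega)]; exact (hhome h).symm
    · -- connector 3: connector 0 of the east tile, at its (0, 14)
      rw [if_pos rfl]
      show oM i j + K.tile.pos[idx] = oM i (j + 1) + (mKind ψ i (j + 1)).posOfRole (.conn 0)
      have hd : (mKind ψ i (j + 1)).isDoubler = false := by rw [mKind_isDoubler]; simp
      rw [posOfRole_conn0 (mKind_isMatrix ψ i (j + 1)) hd, ← K.posAt_eq_getElem hidx, hp, oM_col_succ]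
      exact Prod.ext (by simp) (by simp)
  · rw [h]; simp only [ssemM]
    rcases hr with ⟨h1, h4, -⟩ | ⟨rfl, hf, hc⟩ | ⟨rfl, hx, hc⟩
    · rw [posS_tgadR ψ h1 h4]; exact (hhome h).symm
    · -- a row chord's far rail node: drawn by the west tile at its (72, 20) / (72, 28)
      rw [posS_tgad0]
      have hj1 := one_le_col_of_not_firstCol ψ hi hj hf
      have hl : (mKind ψ i (j - 1)).isLastCol = false := by rw [mKind_isLastCol]; simp; omega
      have hc' : code = 4 ∨ code = 7 := by rcases hc with ⟨rfl, -⟩ | ⟨rfl, -⟩ <;> simp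
      rw [posOfRole_gadNext0 (mKind_isMatrix ψ i (j - 1)) hl hc', ← K.posAt_eq_getElem hidx]
      have : oM i j = oM i (j - 1) + ((72 : ℤ), (0 : ℤ)) := by rw [← oM_col_succ, Nat.sub_add_cancel hj1]
      rw [this]
      rcases hc with ⟨rfl, hp⟩ | ⟨rfl, hp⟩ <;> rw [hp] <;> exact Prod.ext (by simp) (by simp)
    · -- a column chord's far rail node: drawn by the tile above at its (40, 0) / (46, 0)
      rw [posS_tgad5]
      obtain ⟨hi1, hco⟩ := cross_above ψ (by rw [← hK]; exact hx)
      have hc' : code = 4 ∨ code = 7 := by rcases hc with ⟨rfl, -⟩ | ⟨rfl, -⟩ <;> simp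
      rw [posOfRole_gadCo (mKind_isMatrix ψ (i - 1) j) hco hc', ← K.posAt_eq_getElem hidx, ← oM_row_pred hi1 j]
      rcases hc with ⟨rfl, hp⟩ | ⟨rfl, hp⟩ <;> rw [hp] <;> exact Prod.ext (by simp) (by simp)
  · -- the next row chord's box: home (gadget 0 of the east tile)
    rw [h]; simp only [ssemM]
    rw [posS_tgad0, Nat.add_sub_cancel]
    exact (hhome h).symm
  · -- the column chord leaving: home (gadget 5 of the tile below, or the landing gadget)
    rw [h]; simp only [ssemM]
    split_ifs with hV
    · rw [posS_tgad5, Nat.add_sub_cancel]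
      exact (hhome h).symm
    · simp only [posS]
      have : V ψ - 1 = i := by omega
      rw [this]
      exact (hhome h).symm
  · -- doubling cell: home is (0, 0)
    rw [h]; simp only [ssemM, posS]
    have h00 := mKind_isDoubler ψ i j
    rw [← hK, hd] at h00
    obtain ⟨rfl, rfl⟩ : i = 0 ∧ j = 0 := by simpa using h00
    exact (hhome h).symm
  · rw [h]; simp only [ssemM, posS]
    have h00 := mKind_isDoubler ψ i j
    rw [← hK, hd] at h00
    obtain ⟨rfl, rfl⟩ : i = 0 ∧ j = 0 := by simpa using h00
    exact (hhome h).symm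

/-- **Clause placements** (clause widths at most three). [folklore] -/
theorem placed_clause (hw : ∀ q (hq : q < ψ.length), ψ[q].length ≤ 3) {j : ℕ} (hj : j < N ψ) {idx : ℕ}
    (hidx : idx < (cKind ψ j).tile.nv) :
    (ssemC ψ j ((cKind ψ j).role idx)).WF ψ ∧
      (clauseP ψ j).ν idx = SSem.encS ψ (ssemC ψ j ((cKind ψ j).role idx)) ∧
      (clauseP ψ j).shift ((cKind ψ j).tile.pos[idx]) = posS ψ (ssemC ψ j ((cKind ψ j).role idx)) := by
  set K := cKind ψ j with hK
  have hC : K.isClause = true := cKind_isClause ψ j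
  refine ⟨ssemC_wf ψ hw hj hidx, ?_, ?_⟩
  · rw [clauseP_ν]
    refine cName_eq_encS ψ j _ ?_
    rcases K.clause_role_cases hC hidx with ⟨b, h, -⟩ | ⟨h, -⟩ | ⟨h, -⟩ | ⟨code, h, -⟩ | ⟨i, h, -⟩ | h <;> rw [h] <;> trivial
  rw [Placement.shift_eq_add, clauseP_o]
  have hhome : ∀ {ρ : TileRole}, K.role idx = ρ → oC ψ j + K.posOfRole ρ = oC ψ j + K.tile.pos[idx] := fun h => by
    rw [K.posOfRole_eq_of_role hidx h]
  obtain ⟨hq, hm, hjq⟩ := colClause_spec ψ hj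
  have hm3 : colInClause ψ j < 3 := by rw [getD_map_length' ψ hq] at hm; exact lt_of_lt_of_le hm (hw _ hq)
  have hV : 1 ≤ V ψ := V_pos_of_N_pos ψ (by omega)
  rcases K.clause_role_cases hC hidx with ⟨b, h, -⟩ | ⟨h, -⟩ | ⟨h, hl, hp⟩ | ⟨code, h, hc⟩ | ⟨i, h, hi, hiu, -⟩ | h
  · rw [h]; exact (hhome h).symm
  · rw [h]; exact (hhome h).symm
  · -- the next terminal's connector, at its (0, 14)
    rw [h]; simp only [ssemC, posS]
    rw [posOfRole_bconn (cKind_isClause ψ (j + 1)), ← K.posAt_eq_getElem hidx, hp, oC_succ]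
    exact Prod.ext (by simp) (by simp)
  · -- a landing node: drawn by the last matrix row at its (40, 0) / (46, 0)
    rw [h]; simp only [ssemC, posS]
    have hc' : code = 4 ∨ code = 7 := by rcases hc with ⟨rfl, -⟩ | ⟨rfl, -⟩ <;> simp
    rw [posOfRole_gadCo (mKind_isMatrix ψ _ _) (lastRow_hasCo ψ hj) hc', ← K.posAt_eq_getElem hidx, oM_lastRow ψ hV]
    rcases hc with ⟨rfl, hp⟩ | ⟨rfl, hp⟩ <;> rw [hp] <;> exact Prod.ext (by simp) (by simp)
  · -- this column's OR-rail node: home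
    rw [h]; simp only [ssemC, posS]
    have hU := cKind_isUnitK ψ j
    rw [← hK] at hU
    by_cases hu : isUnitCol ψ j = true
    · have hwid : (ψ.map List.length).getD (colClause ψ j) 0 = 1 := by
        unfold isUnitCol at hu; simpa using hu
      have hr0 : colInClause ψ j = 0 := by omega
      have hj' : cstart ψ (colClause ψ j) = j := by omega
      rw [if_pos hu, if_pos hwid, if_pos (hiu (by rw [hU, hu])), hj']
      exact (hhome h).symm
    · have hwid : ¬ (ψ.map List.length).getD (colClause ψ j) 0 = 1 := by
        unfold isUnitCol at hu; simpa using hu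
      have hcode : 6 * colInClause ψ j + i < 18 := by omega
      have hdiv : (6 * colInClause ψ j + i) / 6 = colInClause ψ j := by omega
      have hmod : (6 * colInClause ψ j + i) % 6 = i := by omega
      rw [if_neg hu, if_neg hwid, if_pos hcode, hdiv, hmod, ← hjq]
      exact (hhome h).symm
  · -- this column's inner rung midpoint: home
    rw [h]; simp only [ssemC, posS]
    by_cases hu : isUnitCol ψ j = true
    · have hwid : (ψ.map List.length).getD (colClause ψ j) 0 = 1 := by
        unfold isUnitCol at hu; simpa using hu
      have hj' : cstart ψ (colClause ψ j) = j := by omega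
      rw [if_pos hu, if_pos hwid, if_neg (show ¬ (2 : ℕ) < 2 by norm_num), hj']
      exact (hhome h).symm
    · have hwid : ¬ (ψ.map List.length).getD (colClause ψ j) 0 = 1 := by
        unfold isUnitCol at hu; simpa using hu
      rw [if_neg hu, if_neg hwid, if_neg (show ¬ 18 + colInClause ψ j < 18 by omega),
        if_pos (show 18 + colInClause ψ j < 21 by omega), Nat.add_sub_cancel_left, ← hjq]
      exact (hhome h).symm

/-- **Rung placements.** [folklore] -/
theorem placed_rung {q : ℕ} (hq : q ∈ rungClauses ψ) {idx : ℕ} (hidx : idx < Kind.rung3.tile.nv) :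
    (ssemR q (Kind.rung3.role idx)).WF ψ ∧
      (rungP ψ q).ν idx = SSem.encS ψ (ssemR q (Kind.rung3.role idx)) ∧
      (rungP ψ q).shift (Kind.rung3.tile.pos[idx]) = posS ψ (ssemR q (Kind.rung3.role idx)) := by
  obtain ⟨code, h, hc27, hlow, hhigh⟩ := Kind.rung_role_cases hidx
  obtain ⟨hql, hwid⟩ := (mem_rungClauses_iff ψ).1 hq
  refine ⟨ssemR_wf ψ hidx, by rw [rungP_ν, h]; rfl, ?_⟩
  rw [Placement.shift_eq_add, rungP_o, h]
  simp only [ssemR, posS]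
  rw [if_neg (show ¬ (ψ.map List.length).getD q 0 = 1 by rw [hwid]; norm_num)]
  by_cases hlt : code < 18
  · -- a rail node of column `cstart q + code / 6`: drawn there at (34 + code % 6, 0)
    obtain ⟨hmod, hp⟩ := hlow hlt
    rw [if_pos hlt]
    have hr : code / 6 < 3 := by omega
    have hw3 : ψ[q].length = 3 := by rw [getD_map_length' ψ hql] at hwid; exact hwid
    have hj' : cstart ψ q + code / 6 < N ψ := cstart_add_lt ψ hql (by rw [hw3]; exact hr)
    have hcc : colClause ψ (cstart ψ q + code / 6) = q := colClause_cstart_add ψ hql (by rw [hw3]; exact hr)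
    have hU : (cKind ψ (cstart ψ q + code / 6)).isUnitK = false := by
      rw [cKind_isUnitK]; unfold isUnitCol; rw [hcc, hwid]; simp
    rw [posOfRole_orr (cKind_isClause ψ _) hU hmod, ← Kind.rung3.posAt_eq_getElem hidx, hp, ← oR_add]
    refine Prod.ext ?_ ?_ <;> (simp only [Prod.fst_add, Prod.snd_add]; omega)
  · rw [if_neg hlt, if_neg (show ¬ code < 21 by omega)]
    rw [Kind.rung3.posOfRole_eq_of_role hidx h]

/-- **Every placed vertex**: a structured vertex with its number and canonical position. [folklore] -/
theorem placed (hw : ∀ q (hq : q < ψ.length), ψ[q].length ≤ 3) {P : Placement} (hP : P ∈ placements ψ) {idx : ℕ}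
    (hidx : idx < P.T.nv) : ∃ s : SSem, s.WF ψ ∧ P.ν idx = SSem.encS ψ s ∧ P.shift (P.T.pos[idx]) = posS ψ s := by
  rcases (mem_placements_iff ψ).1 hP with ⟨i, hi, j, hj, rfl⟩ | ⟨j, hj, rfl⟩ | ⟨q, hq, rfl⟩
  · exact ⟨_, placed_matrix ψ hi hj hidx⟩
  · exact ⟨_, placed_clause ψ hw hj hidx⟩
  · exact ⟨_, placed_rung ψ hq hidx⟩

/-- **Two placed vertices with the same name are at the same point.** [folklore] -/
theorem pos_eq_of_ν_eq (hw : ∀ q (hq : q < ψ.length), ψ[q].length ≤ 3) {P P' : Placement} (hP : P ∈ placements ψ)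
    (hP' : P' ∈ placements ψ) {idx idx' : ℕ} (hidx : idx < P.T.nv) (hidx' : idx' < P'.T.nv) (h : P.ν idx = P'.ν idx') :
    P.shift (P.T.pos[idx]) = P'.shift (P'.T.pos[idx']) := by
  obtain ⟨s, hs, hn, hp⟩ := placed ψ hw hP hidx
  obtain ⟨s', hs', hn', hp'⟩ := placed ψ hw hP' hidx'
  rw [hn, hn'] at h
  rw [hp, hp', SSem.encS_injective hs hs' h]

/-! ### The position function of the drawing -/

/-- Members of `namedPos`. [folklore] -/
theorem mem_namedPos_iff {P : Placement} {np : ℕ × GridPoint} :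
    np ∈ namedPos P ↔ ∃ idx < P.T.nv, np = (P.ν idx, P.shift (P.T.pos.getD idx (0, 0))) := by
  unfold namedPos; simp [eq_comm]

/-- **The position function of the drawing agrees with every placement.** [folklore] -/
theorem gposOf_eq (hw : ∀ q (hq : q < ψ.length), ψ[q].length ≤ 3) {P : Placement} (hP : P ∈ placements ψ) {idx : ℕ}
    (hidx : idx < P.T.nv) : gposOf ψ (P.ν idx) = P.shift (P.T.pos[idx]) := by
  unfold gposOf
  set L := (placements ψ).flatMap namedPos with hL
  have hmem : (P.ν idx, P.shift (P.T.pos.getD idx (0, 0))) ∈ L :=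
    List.mem_flatMap.2 ⟨P, hP, mem_namedPos_iff.2 ⟨idx, hidx, rfl⟩⟩
  have hsome : (L.find? fun np => np.1 = P.ν idx).isSome := List.find?_isSome.2 ⟨_, hmem, by simp⟩
  obtain ⟨np, hnp⟩ := Option.isSome_iff_exists.1 hsome
  rw [hnp]
  have hpred := List.find?_some hnp
  simp only [decide_eq_true_eq] at hpred
  obtain ⟨P', hP', hnp'⟩ := List.mem_flatMap.1 (List.mem_of_find?_eq_some hnp)
  obtain ⟨idx', hidx', rfl⟩ := mem_namedPos_iff.1 hnp'
  simp only at hpred ⊢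
  rw [List.getD_eq_getElem _ _ hidx']
  exact (pos_eq_of_ν_eq ψ hw hP hP' hidx hidx' hpred.symm).symm

end FormulaTiles

end Literature.Barriers.CriticalPhenomena.GridSAW

/-!
# The tiling of the grid drawing of the graph of a formula, VI: the placed names are the vertices

For the placements of `GridSAWFormulaTiling.lean` (the grid drawing `E₀` of
`GridFormula.graphOf ψ`; Liśkiewicz–Ogihara–Toda 2003, Lemma 4 / Theorem 7, tree fact
`GridSAW.LOT2003_lemma4_gadgets`):

* `SSem.Vtx` — the structured vertices that ARE vertices of `graphOf ψ` (block vertex in the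
  cell type's vertex list, gadget code below the gadget's size), `SSem.encS_mem_vertsListOf`;
* every placed name is such a vertex (`placed_vtx`), hence listed in `vertsListOf ψ`
  (`ν_mem_vertsListOf`, the first half of `TilingHypsGeo.pos_eq`);
* every structured vertex is named by some placement (`SSem.named`), and every listed vertex is
  a structured vertex (`exists_vtx_of_mem`): **`cover`** (`TilingHypsGeo.cover`);
* `placements_nodup`, `vertsListOf_nodup` (`TilingHypsGeo.nodup`, `.nodup_verts`).

## References

* M. Liśkiewicz, M. Ogihara, S. Toda, TCS 304 (2003) 129–156, §4 (proof of Theorem 7, `E₀`).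
-/

namespace Literature.Barriers.CriticalPhenomena.GridSAW

namespace FormulaTiles

open Literature.Computability.Complexity (CNF)
open Literature.Combinatorics.SimpleGraph Literature.Combinatorics.SimpleGraph.GridFormula
open Literature.Combinatorics.SimpleGraph.GridFormula.Slot
open Literature.Combinatorics.SimpleGraph.GridCell (CellTy conn vtx cellTy)
open GridFormulaFP (vertsListOf chainVertsN placeVerts SpecOK specSize placeVerts_eq mem_chainVertsN_iff)

variable (ψ : CNF ℕ)

/-! ### Small facts about the graph's lists -/

/-- Membership in a cell type's vertex list: all sixteen, except that a one-bit cell has twelve. [folklore] -/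
theorem mem_vertList_iff (ty : CellTy) (a : Fin 16) : a ∈ ty.vertList ↔ (ty = .bead → a.val < 12) := by
  cases ty <;> simp [CellTy.vertList]

/-- Members of the vertex list: chain vertices and gadget blocks. [folklore] -/
theorem mem_vertsListOf_iff {v : ℕ} :
    v ∈ vertsListOf ψ ↔ v ∈ chainVertsN ψ ∨ ∃ g < ngadgets ψ, v ∈ placeVerts ψ g := by
  unfold vertsListOf; simp

/-- Members of the chain's vertex list. [folklore] -/
theorem mem_chainVertsN_iff' {v : ℕ} :
    v ∈ chainVertsN ψ ↔ ∃ kc < ncells ψ, v = conn kc ∨ ∃ a ∈ (cellTyAt ψ kc).vertList, v = vtx kc a := by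
  unfold GridFormulaFP.chainVertsN
  simp only [List.mem_flatMap, List.mem_range, List.mem_cons, List.mem_map]
  constructor
  · rintro ⟨kc, hk, h | ⟨a, ha, rfl⟩⟩
    · exact ⟨kc, hk, Or.inl h⟩
    · exact ⟨kc, hk, Or.inr ⟨a, ha, rfl⟩⟩
  · rintro ⟨kc, hk, h | ⟨a, ha, rfl⟩⟩
    · exact ⟨kc, hk, Or.inl h⟩
    · exact ⟨kc, hk, Or.inr ⟨a, ha, rfl⟩⟩

/-- Members of a gadget's block. [folklore] -/
theorem mem_placeVerts_iff' {g v : ℕ} :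
    v ∈ placeVerts ψ g ↔ ∃ s, gad ψ g = some s ∧ SpecOK ψ s ∧ ∃ code < specSize s, v = gbase ψ g + code := by
  rw [placeVerts_eq]
  cases hg : gad ψ g with
  | none => simp
  | some s =>
    simp only [Option.elim_some, Option.some.injEq, exists_eq_left']
    split_ifs with hok
    · simp [hok, eq_comm]
    · simp [hok]

/-- **The guard of every tile gadget holds.** [folklore] -/
theorem specOK_tileGad {i j r : ℕ} (hi : i < V ψ) (hj : j < N ψ) {s : GadSpec} (h : tileGad ψ i j r = some s) : SpecOK ψ s := by
  have hrow : (rowOutSlot ψ i (j - 1)).1 ≠ (rowOutSlot ψ i (j - 1)).2 := by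
    unfold rowOutSlot; split_ifs <;> decide
  have hcol : (colOutSlot ψ (i - 1) j).1 ≠ (colOutSlot ψ (i - 1) j).2 := by
    unfold colOutSlot; split_ifs <;> decide
  have hc0 := tileCell_lt_ncells ψ (c := 0) hi hj (by norm_num)
  have hc1 := tileCell_lt_ncells ψ (c := 1) hi hj (by norm_num)
  have hc2 := tileCell_lt_ncells ψ (c := 2) hi hj (by norm_num)
  have hne : ∀ {c c' : ℕ}, c ≠ c' → tileCell ψ i j c ≠ tileCell ψ i j c' := fun h => by unfold tileCell; omega
  have hr0 : j ≠ 0 → SpecOK ψ (.xor (tileCell ψ i (j - 1) 2) (rowOutSlot ψ i (j - 1)) (tileCell ψ i j 0) pN0) ∧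
      SpecOK ψ (.xor (tileCell ψ i (j - 1) 2) (rowOutSlot ψ i (j - 1)) (tileCell ψ i j 0) bN3) := fun hj0 =>
    ⟨⟨tileCell_lt_ncells ψ (c := 2) hi (by omega) (by norm_num), hc0, by unfold tileCell; omega, hrow, by decide⟩,
     ⟨tileCell_lt_ncells ψ (c := 2) hi (by omega) (by norm_num), hc0, by unfold tileCell; omega, hrow, by decide⟩⟩
  unfold tileGad at h
  by_cases hx : tileTy ψ i j = .cross
  · rw [if_pos hx] at h
    have hi1 : 1 ≤ i := one_le_of_cross ψ hx
    rcases Nat.lt_or_ge r 6 with hr | hr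
    · interval_cases r
      · by_cases hj0 : j = 0
        · simp [hj0] at h
        · simp only [↓reduceIte, if_neg hj0, Option.some.injEq] at h
          subst h; exact (hr0 hj0).1
      · norm_num at h; subst h; exact ⟨hc0, hc1, hne (by norm_num), by decide, by decide⟩
      · norm_num at h; subst h; exact ⟨hc0, hc1, hne (by norm_num), by decide, by decide⟩
      · norm_num at h; subst h; exact ⟨hc1, hc2, hne (by norm_num), by decide, by decide⟩
      · norm_num at h; subst h; exact ⟨hc0, hc2, hne (by norm_num), by decide, by decide⟩
      · norm_num at h; subst h
        exact ⟨tileCell_lt_ncells ψ (c := 1) (by omega) hj (by norm_num), hc0, by unfold tileCell; omega, hcol, by decide⟩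
    · simp only [show r ≠ 0 by omega, show r ≠ 1 by omega, show r ≠ 2 by omega, show r ≠ 3 by omega, show r ≠ 4 by omega,
        show r ≠ 5 by omega, ↓reduceIte] at h
      exact absurd h (by simp)
  · rw [if_neg hx] at h
    rcases Nat.lt_or_ge r 3 with hr | hr
    · interval_cases r
      · by_cases hj0 : j = 0
        · simp [hj0] at h
        · simp only [↓reduceIte, if_neg hj0, Option.some.injEq] at h
          subst h; exact (hr0 hj0).2
      · norm_num at h; subst h; exact ⟨hc0, hc1, hne (by norm_num), by decide, by decide⟩
      · norm_num at h; subst h; exact ⟨hc1, hc2, hne (by norm_num), by decide, by decide⟩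
    · simp only [show r ≠ 0 by omega, show r ≠ 1 by omega, show r ≠ 2 by omega, ↓reduceIte] at h
      exact absurd h (by simp)

/-- **The guard of every landing gadget holds.** [folklore] -/
theorem specOK_land {j : ℕ} (hj : j < N ψ) :
    SpecOK ψ (.xor (tileCell ψ (V ψ - 1) j 1) (colOutSlot ψ (V ψ - 1) j) (clauseBead ψ j) (landSlot ψ j)) := by
  have hV : 1 ≤ V ψ := V_pos_of_N_pos ψ (by omega)
  refine ⟨tileCell_lt_ncells ψ (by omega) hj (by norm_num), clauseBead_lt_ncells ψ hj, ?_, ?_, ?_⟩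
  · have := tileCell_lt ψ (c := 1) (i := V ψ - 1) (by omega) hj (by norm_num)
    unfold clauseBead; omega
  · unfold colOutSlot; split_ifs <;> decide
  · unfold landSlot; split_ifs <;> decide

/-- The clause gadget of a clause of width one or three, with its guard. [folklore] -/
theorem clauseGad_eq {q : ℕ} (hq : q < ψ.length) :
    clauseGad ψ q = if ψ[q].length = 1 then some (.or1 (clauseBead ψ (cstart ψ q)))
      else if ψ[q].length = 3 then some (.or3 (clauseBead ψ (cstart ψ q))) else none := by
  unfold clauseGad; rw [dif_pos hq]

/-! ### Structured vertices that are vertices -/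

namespace SSem

variable {ψ}

/-- **The structured vertices that are vertices of `graphOf ψ`.** [folklore] -/
def Vtx (ψ : CNF ℕ) : SSem → Prop
  | cellV i j c b => i < V ψ ∧ j < N ψ ∧ c ≤ 2 ∧ ∃ a ∈ (cellTyAt ψ (tileCell ψ i j c)).vertList, a.val = b
  | tconn i j c => i < V ψ ∧ j < N ψ ∧ c ≤ 2
  | dcellV b => 1 ≤ N ψ ∧ ∃ a ∈ (cellTyAt ψ 0).vertList, a.val = b
  | sconn => 1 ≤ N ψ
  | beadV j b => j < N ψ ∧ ∃ a ∈ (cellTyAt ψ (clauseBead ψ j)).vertList, a.val = b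
  | bconnS j => j < N ψ
  | tgad i j r code => i < V ψ ∧ j < N ψ ∧ r < 8 ∧ ∃ s, gad ψ (8 * (i * N ψ + j) + r) = some s ∧ SpecOK ψ s ∧ code < specSize s
  | landS j code => j < N ψ ∧ ∃ s, gad ψ (8 * (V ψ * N ψ) + j) = some s ∧ SpecOK ψ s ∧ code < specSize s
  | orS q code => q < ψ.length ∧ ∃ s, gad ψ (8 * (V ψ * N ψ) + N ψ + q) = some s ∧ SpecOK ψ s ∧ code < specSize s

/-- Sizes of specifications are below `64`. [folklore] -/
theorem specSize_lt (s : GadSpec) : specSize s < 64 := by cases s <;> simp [GridFormulaFP.specSize]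

/-- Vertices are well formed. [folklore] -/
theorem Vtx.wf {s : SSem} (h : s.Vtx ψ) : s.WF ψ := by
  cases s with
  | cellV i j c b => obtain ⟨hi, hj, hc, a, -, rfl⟩ := h; exact ⟨hi, hj, hc, a.isLt⟩
  | tconn i j c => exact h
  | dcellV b => obtain ⟨-, a, -, rfl⟩ := h; exact a.isLt
  | sconn => trivial
  | beadV j b => obtain ⟨hj, a, -, rfl⟩ := h; exact ⟨hj, a.isLt⟩
  | bconnS j => exact h
  | tgad i j r code => obtain ⟨hi, hj, hr, s, -, -, hc⟩ := h; exact ⟨hi, hj, hr, hc.trans (specSize_lt s)⟩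
  | landS j code => obtain ⟨hj, s, -, -, hc⟩ := h; exact ⟨hj, hc.trans (specSize_lt s)⟩
  | orS q code => obtain ⟨-, s, -, -, hc⟩ := h; exact hc.trans (specSize_lt s)

/-- **A structured vertex that is a vertex is listed in `vertsListOf ψ`.** [folklore] -/
theorem Vtx.encS_mem {s : SSem} (h : s.Vtx ψ) : encS ψ s ∈ vertsListOf ψ := by
  rw [mem_vertsListOf_iff]
  have hng : ngadgets ψ = 8 * (V ψ * N ψ) + N ψ + ψ.length := rfl
  cases s with
  | cellV i j c b =>
    obtain ⟨hi, hj, hc, a, ha, rfl⟩ := h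
    exact Or.inl ((mem_chainVertsN_iff' ψ).2 ⟨_, tileCell_lt_ncells ψ hi hj (by omega), Or.inr ⟨a, ha, rfl⟩⟩)
  | tconn i j c =>
    obtain ⟨hi, hj, hc⟩ := h
    exact Or.inl ((mem_chainVertsN_iff' ψ).2 ⟨_, tileCell_lt_ncells ψ hi hj (by omega), Or.inl rfl⟩)
  | dcellV b =>
    obtain ⟨-, a, ha, rfl⟩ := h
    exact Or.inl ((mem_chainVertsN_iff' ψ).2 ⟨0, by unfold ncells; omega, Or.inr ⟨a, ha, by simp [encS, GridCell.vtx]⟩⟩)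
  | sconn => exact Or.inl ((mem_chainVertsN_iff' ψ).2 ⟨0, by unfold ncells; omega, Or.inl rfl⟩)
  | beadV j b =>
    obtain ⟨hj, a, ha, rfl⟩ := h
    exact Or.inl ((mem_chainVertsN_iff' ψ).2 ⟨_, clauseBead_lt_ncells ψ hj, Or.inr ⟨a, ha, rfl⟩⟩)
  | bconnS j => exact Or.inl ((mem_chainVertsN_iff' ψ).2 ⟨_, clauseBead_lt_ncells ψ h, Or.inl rfl⟩)
  | tgad i j r code =>
    obtain ⟨hi, hj, hr, s, hs, hok, hc⟩ := h
    exact Or.inr ⟨_, by rw [hng]; have := gad_lt hi hj hr; omega, (mem_placeVerts_iff' ψ).2 ⟨s, hs, hok, code, hc, rfl⟩⟩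
  | landS j code =>
    obtain ⟨hj, s, hs, hok, hc⟩ := h
    exact Or.inr ⟨_, by rw [hng]; omega, (mem_placeVerts_iff' ψ).2 ⟨s, hs, hok, code, hc, rfl⟩⟩
  | orS q code =>
    obtain ⟨hq, s, hs, hok, hc⟩ := h
    exact Or.inr ⟨_, by rw [hng]; omega, (mem_placeVerts_iff' ψ).2 ⟨s, hs, hok, code, hc, rfl⟩⟩

end SSem

/-! ### Placed roles are vertices -/

/-- Any `b < 12` is in every cell type's vertex list; any `b < 16` in a two-bit cell's. [folklore] -/
theorem exists_mem_vertList {ty : CellTy} {b : ℕ} (hb : b < 16) (h : ty = .bead → b < 12) :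
    ∃ a ∈ ty.vertList, a.val = b :=
  ⟨⟨b, hb⟩, (mem_vertList_iff ty _).2 h, rfl⟩

/-- Unpacking `expectedRoles` of a matrix kind. [folklore] -/
theorem mem_expectedRoles_matrix {K : Kind} (hM : K.isMatrix = true) {ρ : TileRole} (h : ρ ∈ K.expectedRoles) :
    (∃ c b, ρ = .cell c b ∧ c < 3 ∧ b < (if K.isCross then 16 else 12)) ∨
    (∃ c, ρ = .conn c ∧ (c ≤ 2 ∨ (c = 3 ∧ K.isLastCol = false))) ∨
    (∃ r code, ρ = .gad r code ∧ code < 12 ∧ 1 ≤ r ∧ (r ≤ 2 ∨ (r ≤ 4 ∧ K.isCross = true))) ∨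
    (∃ code, ρ = .gadNext0 code ∧ code < 12 ∧ K.isLastCol = false) ∨
    (∃ code, ρ = .gadCo code ∧ code < 12 ∧ K.hasCo = true) ∨
    (∃ code, ρ = .gad 0 code ∧ (code = 4 ∨ code = 7) ∧ K.isFirstCol = false) ∨
    (∃ code, ρ = .gad 5 code ∧ (code = 4 ∨ code = 7) ∧ K.isCross = true) ∨
    ((∃ b, ρ = .dcell b ∧ b < 12) ∨ ρ = .s) ∧ K.isDoubler = true := by
  unfold Kind.expectedRoles at h
  rw [if_pos hM] at h
  simp only [List.mem_append, List.mem_flatMap, List.mem_range, List.mem_map, Kind.cellVertsN, List.mem_cons,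
    List.not_mem_nil, or_false] at h
  rcases h with ((((((((⟨c, hc, b, hb, rfl⟩ | h) | h) | ⟨r, hr, code, hcode, rfl⟩) | h) | h) | h) | h) | h)
  · left; refine ⟨c, b, rfl, hc, ?_⟩
    revert hb; cases K.isCross <;> simp
  · right; left
    rcases h with rfl | rfl | rfl
    · exact ⟨0, rfl, Or.inl (by norm_num)⟩
    · exact ⟨1, rfl, Or.inl (by norm_num)⟩
    · exact ⟨2, rfl, Or.inl (by norm_num)⟩
  · right; left
    cases hl : K.isLastCol
    · rw [hl] at h; simp only [Bool.false_eq_true, ↓reduceIte, List.mem_cons, List.not_mem_nil, or_false] at h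
      exact ⟨3, h, Or.inr ⟨rfl, rfl⟩⟩
    · rw [hl] at h; simp at h
  · right; right; left; refine ⟨r, code, rfl, hcode, ?_⟩
    revert hr; cases hx : K.isCross <;> simp <;> omega
  · right; right; right; left
    cases hl : K.isLastCol
    · rw [hl] at h; simp only [Bool.false_eq_true, ↓reduceIte, List.mem_map, List.mem_range] at h
      obtain ⟨code, hc, rfl⟩ := h
      exact ⟨code, rfl, hc, rfl⟩
    · rw [hl] at h; simp at h
  · right; right; right; right; left
    cases hco : K.hasCo
    · rw [hco] at h; simp at h
    · rw [hco] at h; simp only [↓reduceIte, List.mem_map, List.mem_range] at h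
      obtain ⟨code, hc, rfl⟩ := h
      exact ⟨code, rfl, hc, rfl⟩
  · right; right; right; right; right; left
    cases hf : K.isFirstCol
    · rw [hf] at h; simp only [Bool.false_eq_true, ↓reduceIte, List.mem_cons, List.not_mem_nil, or_false] at h
      rcases h with rfl | rfl
      · exact ⟨4, rfl, Or.inl rfl, rfl⟩
      · exact ⟨7, rfl, Or.inr rfl, rfl⟩
    · rw [hf] at h; simp at h
  · right; right; right; right; right; right; left
    cases hx : K.isCross
    · rw [hx] at h; simp at h
    · rw [hx] at h; simp only [↓reduceIte, List.mem_cons, List.not_mem_nil, or_false] at h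
      rcases h with rfl | rfl
      · exact ⟨4, rfl, Or.inl rfl, rfl⟩
      · exact ⟨7, rfl, Or.inr rfl, rfl⟩
  · right; right; right; right; right; right; right
    cases hd : K.isDoubler
    · rw [hd] at h; simp at h
    · rw [hd] at h; simp only [↓reduceIte, List.mem_append, List.mem_map, List.mem_range, List.mem_cons,
        List.not_mem_nil, or_false] at h
      rcases h with ⟨b, hb, rfl⟩ | rfl
      · exact ⟨Or.inl ⟨b, rfl, hb⟩, rfl⟩
      · exact ⟨Or.inr rfl, rfl⟩

/-- Unpacking `expectedRoles` of a clause kind. [folklore] -/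
theorem mem_expectedRoles_clause {K : Kind} (hC : K.isClause = true) {ρ : TileRole} (h : ρ ∈ K.expectedRoles) :
    (∃ b, ρ = .bead b ∧ b < 12) ∨ ρ = .bconn ∨ (ρ = .bconnN ∧ K.isLastClause = false) ∨
    (ρ = .land 4 ∨ ρ = .land 7) ∨ (∃ i, ρ = .orr i ∧ (if K.isUnitK then i < 2 else i < 6)) ∨ ρ = .orm := by
  obtain ⟨hR, hM⟩ := Kind.ne_rung_of_isClause hC
  unfold Kind.expectedRoles at h
  rw [hM, if_pos hC] at h
  simp only [Bool.false_eq_true, ↓reduceIte, List.mem_append, List.mem_map, List.mem_range, List.mem_cons,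
    List.not_mem_nil, or_false] at h
  rcases h with ((((⟨b, hb, rfl⟩ | rfl) | h) | h) | h)
  · exact Or.inl ⟨b, rfl, hb⟩
  · exact Or.inr (Or.inl rfl)
  · cases hl : K.isLastClause
    · rw [hl] at h; simp only [Bool.false_eq_true, ↓reduceIte, List.mem_cons, List.not_mem_nil, or_false] at h
      exact Or.inr (Or.inr (Or.inl ⟨h, rfl⟩))
    · rw [hl] at h; simp at h
  · exact Or.inr (Or.inr (Or.inr (Or.inl h)))
  · right; right; right; right
    cases hu : K.isUnitK
    · rw [hu] at h; simp only [Bool.false_eq_true, ↓reduceIte, List.mem_cons, List.not_mem_nil, or_false] at h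
      rcases h with rfl | rfl | rfl | rfl | rfl | rfl | rfl
      · exact Or.inl ⟨0, rfl, by norm_num⟩
      · exact Or.inl ⟨1, rfl, by norm_num⟩
      · exact Or.inl ⟨2, rfl, by norm_num⟩
      · exact Or.inl ⟨3, rfl, by norm_num⟩
      · exact Or.inl ⟨4, rfl, by norm_num⟩
      · exact Or.inl ⟨5, rfl, by norm_num⟩
      · exact Or.inr rfl
    · rw [hu] at h; simp only [↓reduceIte, List.mem_cons, List.not_mem_nil, or_false] at h
      rcases h with rfl | rfl | rfl
      · exact Or.inl ⟨0, rfl, by norm_num⟩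
      · exact Or.inl ⟨1, rfl, by norm_num⟩
      · exact Or.inr rfl

/-- Unpacking `expectedRoles` of the rung kind. [folklore] -/
theorem mem_expectedRoles_rung {ρ : TileRole} (h : ρ ∈ Kind.rung3.expectedRoles) :
    ∃ code, ρ = .or code ∧ (code ∈ [0, 2, 3, 4, 6, 8, 9, 10, 12, 14, 15, 16] ∨ (21 ≤ code ∧ code < 27)) := by
  unfold Kind.expectedRoles at h
  simp only [Kind.isMatrix, Kind.isClause, Bool.false_eq_true, ↓reduceIte, List.mem_map, List.mem_append] at h
  obtain ⟨code, hc, rfl⟩ := h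
  refine ⟨code, rfl, ?_⟩
  rcases hc with hc | hc
  · exact Or.inl hc
  · right; simp only [List.mem_cons, List.not_mem_nil, or_false] at hc; omega

/-- The tile gadget `r ∈ {1, 2}` exists in every tile, `r ∈ {3, 4}` in crossing tiles; all are
XOR-chords (size `12`). [folklore] -/
theorem tileGad_some {i j r : ℕ} (h1 : 1 ≤ r) (hr : r ≤ 2 ∨ (r ≤ 4 ∧ tileTy ψ i j = .cross)) :
    ∃ k₁ e₁ k₂ e₂, tileGad ψ i j r = some (.xor k₁ e₁ k₂ e₂) := by
  unfold tileGad
  rcases hr with hr | ⟨hr, hx⟩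
  · by_cases hx : tileTy ψ i j = .cross
    · rw [if_pos hx]; interval_cases r <;> simp
    · rw [if_neg hx]; interval_cases r <;> simp
  · rw [if_pos hx]; interval_cases r <;> simp

/-- The row chord entering tile `(i, j)`, `j ≥ 1`, exists (size `12`). [folklore] -/
theorem tileGad_zero_some {i j : ℕ} (hj : 1 ≤ j) : ∃ k₁ e₁ k₂ e₂, tileGad ψ i j 0 = some (.xor k₁ e₁ k₂ e₂) := by
  have hj0 : j ≠ 0 := by omega
  by_cases hx : tileTy ψ i j = .cross <;> simp [tileGad, hx, hj0]

/-- The column chord entering a crossing tile exists (size `12`). [folklore] -/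
theorem tileGad_five_some {i j : ℕ} (hx : tileTy ψ i j = .cross) : ∃ k₁ e₁ k₂ e₂, tileGad ψ i j 5 = some (.xor k₁ e₁ k₂ e₂) := by
  unfold tileGad; rw [if_pos hx]; simp

/-- `firstOccs` keeps a nonempty accumulator's head. [folklore] -/
theorem firstOccs_head? : ∀ (acc l : List ℕ), acc ≠ [] → (firstOccs acc l).head? = acc.head?
  | acc, [], _ => rfl
  | acc, x :: l, h => by
    unfold firstOccs insertNew
    split_ifs
    · exact firstOccs_head? acc l h
    · rw [firstOccs_head? (acc ++ [x]) l (by simp [h]), List.head?_append_of_ne_nil _ h]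

/-- **The variable of column `0` is the variable of row `0`.** [folklore] -/
theorem rowOf_varOf_zero (hN : 1 ≤ N ψ) : rowOf ψ (varOf ψ 0) = 0 := by
  have hcols : cols ψ ≠ [] := by
    intro h; unfold N at hN; rw [h] at hN; simp at hN
  obtain ⟨c, cs, hc⟩ := List.exists_cons_of_ne_nil hcols
  have hv : varOf ψ 0 = c.1 := by unfold varOf; rw [hc]; rfl
  have hrows : (varRows ψ).head? = some c.1 := by
    unfold varRows; rw [hc, List.map_cons]
    show (firstOccs (insertNew [] c.1) (cs.map Prod.fst)).head? = some c.1
    unfold insertNew; simp only [List.not_mem_nil, ↓reduceIte, List.nil_append]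
    rw [firstOccs_head? _ _ (by simp)]; rfl
  unfold rowOf
  rw [hv]
  cases hr : varRows ψ with
  | nil => rw [hr] at hrows; simp at hrows
  | cons y ys =>
    rw [hr] at hrows
    simp only [List.head?_cons, Option.some.injEq] at hrows
    subst hrows
    simp

/-- A tile with a column chord leaving has a crossing tile (or the clause row) below. [folklore] -/
theorem cross_below_of_hasCo {i j : ℕ} (hco : (mKind ψ i j).hasCo = true) (hi : i + 1 < V ψ) : tileTy ψ (i + 1) j = .cross := by
  rw [tileTy_eq_cross_iff]
  by_cases h00 : i = 0 ∧ j = 0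
  · obtain ⟨rfl, rfl⟩ := h00
    have hN : 1 ≤ N ψ := le_trans (by omega) (V_le_N ψ)
    have := rowOf_varOf_zero ψ hN
    omega
  · rw [mKind_hasCo ψ i j h00] at hco
    have : tileTy ψ i j ≠ .empty := by simpa using hco
    have h2 := (tileTy_eq_empty_iff ψ (i := i) (j := j)).not.1 this
    omega

/-- **The structured vertex of a role of a placed matrix tile is a vertex.** [folklore] -/
theorem ssemM_vtx {i j : ℕ} (hi : i < V ψ) (hj : j < N ψ) {idx : ℕ} (hidx : idx < (mKind ψ i j).tile.nv) :
    (ssemM ψ i j ((mKind ψ i j).role idx)).Vtx ψ := by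
  set K := mKind ψ i j with hK
  have hM : K.isMatrix = true := mKind_isMatrix ψ i j
  have hN1 : 1 ≤ N ψ := by omega
  have hmem := (K.mem_roles_iff).1 (K.role_mem_roles hidx)
  have hcross : K.isCross = true → ¬ (i = 0 ∧ j = 0) ∧ tileTy ψ i j = .cross := fun hx => by
    have h00 : ¬ (i = 0 ∧ j = 0) := by
      rintro ⟨rfl, rfl⟩
      have hd := mKind_isDoubler ψ 0 0
      simp only [and_self, decide_true] at hd
      revert hx hd; rw [hK]; cases mKind ψ 0 0 <;> simp [Kind.isCross, Kind.isDoubler]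
    refine ⟨h00, ?_⟩
    have := mKind_isCross ψ i j h00
    rw [← hK, hx] at this
    simpa using this.symm
  rcases mem_expectedRoles_matrix hM hmem with ⟨c, b, h, hc, hb⟩ | ⟨c, h, hc⟩ | ⟨r, code, h, hcode, h1, hr⟩ | ⟨code, h, hcode, hl⟩ |
      ⟨code, h, hcode, hco⟩ | ⟨code, h, hc, hf⟩ | ⟨code, h, hc, hx⟩ | ⟨h, hd⟩
  · rw [h]
    refine ⟨hi, hj, by omega, exists_mem_vertList (by split_ifs at hb <;> omega) fun hbead => ?_⟩
    by_cases hx : K.isCross = true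
    · exfalso
      obtain ⟨-, hxx⟩ := hcross hx
      rw [cellTyAt_tileCell ψ hi hj hc, if_pos hxx] at hbead
      split_ifs at hbead
    · simp [hx] at hb; exact hb
  · rw [h]; simp only [ssemM]
    rcases hc with hc | ⟨rfl, hl⟩
    · rw [if_neg (show c ≠ 3 by omega)]; exact ⟨hi, hj, hc⟩
    · rw [if_pos rfl]
      rw [hK, mKind_isLastCol] at hl
      have hne : ¬ j + 1 = N ψ := by simpa using hl
      exact ⟨hi, by omega, by norm_num⟩
  · rw [h]
    have hr' : r ≤ 2 ∨ (r ≤ 4 ∧ tileTy ψ i j = .cross) := hr.imp_right fun ⟨h4, hx⟩ => ⟨h4, (hcross hx).2⟩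
    obtain ⟨k₁, e₁, k₂, e₂, hg⟩ := tileGad_some ψ (i := i) (j := j) h1 hr'
    refine ⟨hi, hj, by omega, _, ?_, specOK_tileGad ψ hi hj hg, by simpa [GridFormulaFP.specSize] using hcode⟩
    rw [gad_tile ψ hi hj (by omega), hg]
  · rw [h]
    rw [hK, mKind_isLastCol] at hl
    have hne : ¬ j + 1 = N ψ := by simpa using hl
    have hj1 : j + 1 < N ψ := by omega
    obtain ⟨k₁, e₁, k₂, e₂, hg⟩ := tileGad_zero_some ψ (i := i) (j := j + 1) (by omega)
    refine ⟨hi, hj1, by norm_num, _, ?_, specOK_tileGad ψ hi hj1 hg, by simpa [GridFormulaFP.specSize] using hcode⟩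
    rw [gad_tile ψ hi hj1 (by norm_num), hg]
  · rw [h]; simp only [ssemM]
    split_ifs with hV
    · have hx := cross_below_of_hasCo ψ (by rw [← hK]; exact hco) hV
      obtain ⟨k₁, e₁, k₂, e₂, hg⟩ := tileGad_five_some ψ hx
      refine ⟨hV, hj, by norm_num, _, ?_, specOK_tileGad ψ hV hj hg, by simpa [GridFormulaFP.specSize] using hcode⟩
      rw [gad_tile ψ hV hj (by norm_num), hg]
    · refine ⟨hj, _, gad_land ψ hj, specOK_land ψ hj, by simpa [GridFormulaFP.specSize] using hcode⟩
  · rw [h]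
    have hj1 := one_le_col_of_not_firstCol ψ hi hj (by rw [← hK]; exact hf)
    obtain ⟨k₁, e₁, k₂, e₂, hg⟩ := tileGad_zero_some ψ (i := i) (j := j) hj1
    refine ⟨hi, hj, by norm_num, _, ?_, specOK_tileGad ψ hi hj hg, ?_⟩
    · rw [gad_tile ψ hi hj (by norm_num), hg]
    · rcases hc with rfl | rfl <;> simp [GridFormulaFP.specSize]
  · rw [h]
    obtain ⟨-, hxx⟩ := hcross hx
    obtain ⟨k₁, e₁, k₂, e₂, hg⟩ := tileGad_five_some ψ hxx
    refine ⟨hi, hj, by norm_num, _, ?_, specOK_tileGad ψ hi hj hg, ?_⟩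
    · rw [gad_tile ψ hi hj (by norm_num), hg]
    · rcases hc with rfl | rfl <;> simp [GridFormulaFP.specSize]
  · rcases h with ⟨b, h, hb⟩ | h
    · rw [h]; exact ⟨hN1, exists_mem_vertList (by omega) fun _ => hb⟩
    · rw [h]; exact hN1

/-- **The structured vertex of a role of a placed clause tile is a vertex** (normal-form widths). [folklore] -/
theorem ssemC_vtx (hw : ∀ q (hq : q < ψ.length), ψ[q].length = 1 ∨ ψ[q].length = 3) {j : ℕ} (hj : j < N ψ) {idx : ℕ}
    (hidx : idx < (cKind ψ j).tile.nv) : (ssemC ψ j ((cKind ψ j).role idx)).Vtx ψ := by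
  set K := cKind ψ j with hK
  have hC : K.isClause = true := cKind_isClause ψ j
  have hmem := (K.mem_roles_iff).1 (K.role_mem_roles hidx)
  obtain ⟨hq, hm, hjq⟩ := colClause_spec ψ hj
  have hU : K.isUnitK = isUnitCol ψ j := by rw [hK]; exact cKind_isUnitK ψ j
  have hgadC := gad_clause ψ (colClause ψ j)
  rw [clauseGad_eq ψ hq] at hgadC
  rcases mem_expectedRoles_clause hC hmem with ⟨b, h, hb⟩ | h | ⟨h, hl⟩ | h | ⟨i, h, hi⟩ | h
  · rw [h]; exact ⟨hj, exists_mem_vertList (by omega) fun _ => hb⟩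
  · rw [h]; exact hj
  · rw [h]
    rw [hK, cKind_isLastClause] at hl
    have hne : ¬ j + 1 = N ψ := by simpa using hl
    exact show j + 1 < N ψ by omega
  · have hv : ∀ code, code = 4 ∨ code = 7 → (SSem.landS j code).Vtx ψ := fun code hc =>
      ⟨hj, _, gad_land ψ hj, specOK_land ψ hj, by rcases hc with rfl | rfl <;> simp [GridFormulaFP.specSize]⟩
    rcases h with h | h
    · rw [h]; exact hv 4 (Or.inl rfl)
    · rw [h]; exact hv 7 (Or.inr rfl)
  · rw [h]; simp only [ssemC]
    refine ⟨hq, ?_⟩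
    by_cases hu : isUnitCol ψ j = true
    · have hw1 : ψ[colClause ψ j].length = 1 := by
        unfold isUnitCol at hu; rw [decide_eq_true_eq, getD_map_length' ψ hq] at hu; exact hu
      rw [if_pos hw1] at hgadC
      rw [hU, hu] at hi
      refine ⟨_, hgadC, ?_, ?_⟩
      · show clauseBead ψ (cstart ψ (colClause ψ j)) < ncells ψ
        exact clauseBead_lt_ncells ψ (by omega)
      · rw [if_pos hu]; simp only [GridFormulaFP.specSize]; simp only [↓reduceIte] at hi; omega
    · have hw3 : ψ[colClause ψ j].length = 3 := by
        rcases hw _ hq with h1 | h3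
        · exfalso; apply hu; unfold isUnitCol; rw [decide_eq_true_eq, getD_map_length' ψ hq]; exact h1
        · exact h3
      rw [if_neg (by omega), if_pos hw3] at hgadC
      rw [hU] at hi; simp only [hu] at hi
      rw [getD_map_length' ψ hq, hw3] at hm
      refine ⟨_, hgadC, ?_, ?_⟩
      · show clauseBead ψ (cstart ψ (colClause ψ j)) + 2 < ncells ψ
        have := cstart_add_lt ψ hq (m := 2) (by omega)
        unfold clauseBead ncells; omega
      · rw [if_neg hu]; simp only [GridFormulaFP.specSize, Bool.false_eq_true, ↓reduceIte] at hi ⊢; omega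
  · rw [h]; simp only [ssemC]
    refine ⟨hq, ?_⟩
    by_cases hu : isUnitCol ψ j = true
    · have hw1 : ψ[colClause ψ j].length = 1 := by
        unfold isUnitCol at hu; rw [decide_eq_true_eq, getD_map_length' ψ hq] at hu; exact hu
      rw [if_pos hw1] at hgadC
      exact ⟨_, hgadC, clauseBead_lt_ncells ψ (by omega), by rw [if_pos hu]; simp [GridFormulaFP.specSize]⟩
    · have hw3 : ψ[colClause ψ j].length = 3 := by
        rcases hw _ hq with h1 | h3
        · exfalso; apply hu; unfold isUnitCol; rw [decide_eq_true_eq, getD_map_length' ψ hq]; exact h1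
        · exact h3
      rw [if_neg (by omega), if_pos hw3] at hgadC
      rw [getD_map_length' ψ hq, hw3] at hm
      refine ⟨_, hgadC, ?_, ?_⟩
      · show clauseBead ψ (cstart ψ (colClause ψ j)) + 2 < ncells ψ
        have := cstart_add_lt ψ hq (m := 2) (by omega)
        unfold clauseBead ncells; omega
      · rw [if_neg hu]; simp only [GridFormulaFP.specSize]; omega

/-- **The structured vertex of a role of a placed rung tile is a vertex.** [folklore] -/
theorem ssemR_vtx {q : ℕ} (hq : q ∈ rungClauses ψ) {idx : ℕ} (hidx : idx < Kind.rung3.tile.nv) :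
    (ssemR q (Kind.rung3.role idx)).Vtx ψ := by
  obtain ⟨hql, hwid⟩ := (mem_rungClauses_iff ψ).1 hq
  have hw3 : ψ[q].length = 3 := by rw [getD_map_length' ψ hql] at hwid; exact hwid
  obtain ⟨code, h, hc⟩ := mem_expectedRoles_rung ((Kind.rung3.mem_roles_iff).1 (Kind.rung3.role_mem_roles hidx))
  rw [h]
  have hgadC := gad_clause ψ q
  rw [clauseGad_eq ψ hql, if_neg (by omega), if_pos hw3] at hgadC
  refine ⟨hql, _, hgadC, ?_, ?_⟩
  · show clauseBead ψ (cstart ψ q) + 2 < ncells ψ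
    have := cstart_add_lt ψ hql (m := 2) (by omega)
    unfold clauseBead ncells; omega
  · simp only [GridFormulaFP.specSize]
    rcases hc with hc | hc
    · simp only [List.mem_cons, List.not_mem_nil, or_false] at hc; omega
    · omega

/-- **Every placed name is the number of a structured vertex that is a vertex.** [folklore] -/
theorem placed_vtx (hw : ∀ q (hq : q < ψ.length), ψ[q].length = 1 ∨ ψ[q].length = 3) {P : Placement}
    (hP : P ∈ placements ψ) {idx : ℕ} (hidx : idx < P.T.nv) : ∃ s : SSem, s.Vtx ψ ∧ P.ν idx = SSem.encS ψ s := by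
  have hw' : ∀ q (hq : q < ψ.length), ψ[q].length ≤ 3 := fun q hq => by rcases hw q hq with h | h <;> omega
  rcases (mem_placements_iff ψ).1 hP with ⟨i, hi, j, hj, rfl⟩ | ⟨j, hj, rfl⟩ | ⟨q, hq, rfl⟩
  · exact ⟨_, ssemM_vtx ψ hi hj hidx, (placed_matrix ψ hi hj hidx).2.1⟩
  · exact ⟨_, ssemC_vtx ψ hw hj hidx, (placed_clause ψ hw' hj hidx).2.1⟩
  · exact ⟨_, ssemR_vtx ψ hq hidx, (placed_rung ψ hq hidx).2.1⟩

/-- **Every placed name is a listed vertex.** [folklore] -/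
theorem ν_mem_vertsListOf (hw : ∀ q (hq : q < ψ.length), ψ[q].length = 1 ∨ ψ[q].length = 3) {P : Placement}
    (hP : P ∈ placements ψ) {idx : ℕ} (hidx : idx < P.T.nv) : P.ν idx ∈ vertsListOf ψ := by
  obtain ⟨s, hs, h⟩ := placed_vtx ψ hw hP hidx
  rw [h]; exact hs.encS_mem

/-! ### Every structured vertex is named by a placement -/

/-- An expected role of a placed kind is the role of a local vertex, named accordingly. [folklore] -/
theorem exists_idx_of_expected {P : Placement} {K : Kind} (hT : P.T = K.tile) (name : TileRole → ℕ)
    (hν : ∀ idx, P.ν idx = name (K.role idx)) {ρ : TileRole} (hρ : ρ ∈ K.expectedRoles) :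
    ∃ idx < P.T.nv, P.ν idx = name ρ := by
  obtain ⟨idx, hidx, hr⟩ := K.exists_idx_of_mem_roles ((K.mem_roles_iff).2 hρ)
  exact ⟨idx, by rw [hT]; exact hidx, by rw [hν, hr]⟩

/-- Expected roles of a matrix kind, membership form. [folklore] -/
theorem mem_expectedRoles_of_matrix {K : Kind} (hM : K.isMatrix = true) {ρ : TileRole}
    (h : (∃ c b, ρ = .cell c b ∧ c < 3 ∧ b < (if K.isCross then 16 else 12)) ∨
      (∃ c, ρ = .conn c ∧ (c ≤ 2 ∨ (c = 3 ∧ K.isLastCol = false))) ∨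
      (∃ r code, ρ = .gad r code ∧ code < 12 ∧ 1 ≤ r ∧ (r ≤ 2 ∨ (r ≤ 4 ∧ K.isCross = true))) ∨
      (∃ code, ρ = .gadNext0 code ∧ code < 12 ∧ K.isLastCol = false) ∨
      (∃ code, ρ = .gadCo code ∧ code < 12 ∧ K.hasCo = true) ∨
      ((∃ b, ρ = .dcell b ∧ b < 12) ∨ ρ = .s) ∧ K.isDoubler = true) : ρ ∈ K.expectedRoles := by
  unfold Kind.expectedRoles
  rw [if_pos hM]
  simp only [List.mem_append, List.mem_flatMap, List.mem_range, List.mem_map, Kind.cellVertsN, List.mem_cons,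
    List.not_mem_nil, or_false]
  rcases h with ⟨c, b, rfl, hc, hb⟩ | ⟨c, rfl, hc⟩ | ⟨r, code, rfl, hcode, h1, hr⟩ | ⟨code, rfl, hcode, hl⟩ | ⟨code, rfl, hcode, hco⟩ |
      ⟨h, hd⟩
  · refine Or.inl (Or.inl (Or.inl (Or.inl (Or.inl (Or.inl (Or.inl (Or.inl ⟨c, hc, b, ?_, rfl⟩)))))))
    revert hb; cases K.isCross <;> simp
  · rcases hc with hc | ⟨rfl, hl⟩
    · refine Or.inl (Or.inl (Or.inl (Or.inl (Or.inl (Or.inl (Or.inl (Or.inr ?_)))))))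
      interval_cases c <;> simp
    · refine Or.inl (Or.inl (Or.inl (Or.inl (Or.inl (Or.inl (Or.inr ?_))))))
      rw [hl]; simp
  · refine Or.inl (Or.inl (Or.inl (Or.inl (Or.inl (Or.inr ⟨r, ?_, code, hcode, rfl⟩)))))
    rcases hr with hr | ⟨hr, hx⟩
    · cases K.isCross <;> simp <;> omega
    · rw [hx]; simp; omega
  · refine Or.inl (Or.inl (Or.inl (Or.inl (Or.inr ?_))))
    rw [hl]; simp only [Bool.false_eq_true, ↓reduceIte, List.mem_map, List.mem_range]; exact ⟨code, hcode, rfl⟩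
  · refine Or.inl (Or.inl (Or.inl (Or.inr ?_)))
    rw [hco]; simp only [↓reduceIte, List.mem_map, List.mem_range]; exact ⟨code, hcode, rfl⟩
  · refine Or.inr ?_
    rw [hd]; simp
    rcases h with ⟨b, rfl, hb⟩ | rfl
    · exact Or.inl ⟨b, hb, rfl⟩
    · exact Or.inr rfl

/-- Expected roles of a clause kind, membership form. [folklore] -/
theorem mem_expectedRoles_of_clause {K : Kind} (hC : K.isClause = true) {ρ : TileRole}
    (h : (∃ b, ρ = .bead b ∧ b < 12) ∨ ρ = .bconn ∨ (∃ i, ρ = .orr i ∧ (if K.isUnitK then i < 2 else i < 6)) ∨ ρ = .orm) :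
    ρ ∈ K.expectedRoles := by
  obtain ⟨hR, hM⟩ := Kind.ne_rung_of_isClause hC
  unfold Kind.expectedRoles
  rw [hM, if_pos hC]
  simp only [Bool.false_eq_true, ↓reduceIte, List.mem_append, List.mem_map, List.mem_range, List.mem_cons,
    List.not_mem_nil, or_false]
  rcases h with ⟨b, rfl, hb⟩ | rfl | ⟨i, rfl, hi⟩ | rfl
  · exact Or.inl (Or.inl (Or.inl (Or.inl ⟨b, hb, rfl⟩)))
  · exact Or.inl (Or.inl (Or.inl (Or.inr rfl)))
  · refine Or.inr ?_
    revert hi; cases K.isUnitK <;> simp <;> omega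
  · refine Or.inr ?_
    cases K.isUnitK <;> simp

/-- Expected roles of the rung kind, membership form. [folklore] -/
theorem mem_expectedRoles_of_rung {code : ℕ} (h : 21 ≤ code ∧ code < 27) : TileRole.or code ∈ Kind.rung3.expectedRoles := by
  unfold Kind.expectedRoles
  simp only [Kind.isMatrix, Kind.isClause, Bool.false_eq_true, ↓reduceIte, List.mem_map, List.mem_append, List.mem_cons,
    List.not_mem_nil, or_false, TileRole.or.injEq, exists_eq_right]
  omega

namespace SSem

variable {ψ}

/-- **Every structured vertex that is a vertex is named by some placement** (normal-form widths). [folklore] -/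
theorem Vtx.named (hw : ∀ q (hq : q < ψ.length), ψ[q].length = 1 ∨ ψ[q].length = 3) {s : SSem} (hs : s.Vtx ψ) :
    ∃ P ∈ placements ψ, ∃ idx < P.T.nv, P.ν idx = encS ψ s := by
  have hmat : ∀ {i j : ℕ}, i < V ψ → j < N ψ → ∀ {ρ : TileRole}, ρ ∈ (mKind ψ i j).expectedRoles →
      (match ρ with | .cell _ _ | .conn _ | .gad _ _ | .gadNext0 _ | .gadCo _ | .dcell _ | .s => True | _ => False) →
      ∃ P ∈ placements ψ, ∃ idx < P.T.nv, P.ν idx = encS ψ (ssemM ψ i j ρ) := by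
    intro i j hi hj ρ hρ hcls
    obtain ⟨idx, hidx, hn⟩ := exists_idx_of_expected (P := matrixP ψ i j) rfl (mName ψ i j) (fun _ => rfl) hρ
    exact ⟨_, (mem_placements_iff ψ).2 (Or.inl ⟨i, hi, j, hj, rfl⟩), idx, hidx, by rw [hn, mName_eq_encS ψ i j ρ hcls]⟩
  have hcla : ∀ {j : ℕ}, j < N ψ → ∀ {ρ : TileRole}, ρ ∈ (cKind ψ j).expectedRoles →
      (match ρ with | .bead _ | .bconn | .bconnN | .land _ | .orr _ | .orm => True | _ => False) →
      ∃ P ∈ placements ψ, ∃ idx < P.T.nv, P.ν idx = encS ψ (ssemC ψ j ρ) := by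
    intro j hj ρ hρ hcls
    obtain ⟨idx, hidx, hn⟩ := exists_idx_of_expected (P := clauseP ψ j) rfl (cName ψ j) (fun _ => rfl) hρ
    exact ⟨_, (mem_placements_iff ψ).2 (Or.inr (Or.inl ⟨j, hj, rfl⟩)), idx, hidx, by rw [hn, cName_eq_encS ψ j ρ hcls]⟩
  have h00tap : 1 ≤ N ψ → tileTy ψ 0 0 ≠ .cross := fun hN h => by
    rw [tileTy_eq_cross_iff] at h; omega
  cases s with
  | cellV i j c b =>
    obtain ⟨hi, hj, hc, a, ha, rfl⟩ := hs
    refine hmat hi hj (mem_expectedRoles_of_matrix (mKind_isMatrix ψ i j) (Or.inl ⟨c, a.val, rfl, by omega, ?_⟩)) trivial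
    split_ifs with hx
    · exact a.isLt
    · refine (mem_vertList_iff _ a).1 ha ?_
      rw [cellTyAt_tileCell ψ hi hj (by omega), if_neg]
      intro hxx
      by_cases h00 : i = 0 ∧ j = 0
      · obtain ⟨rfl, rfl⟩ := h00; exact h00tap (by omega) hxx
      · rw [mKind_isCross ψ i j h00] at hx; exact hx (by simpa using hxx)
  | tconn i j c =>
    obtain ⟨hi, hj, hc⟩ := hs
    have := hmat hi hj (mem_expectedRoles_of_matrix (mKind_isMatrix ψ i j) (Or.inr (Or.inl ⟨c, rfl, Or.inl hc⟩))) trivial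
    simpa [ssemM, show c ≠ 3 by omega] using this
  | dcellV b =>
    obtain ⟨hN, a, ha, rfl⟩ := hs
    have hV : 0 < V ψ := V_pos_of_N_pos ψ hN
    have hb : a.val < 12 := (mem_vertList_iff _ a).1 ha (cellTyAt_zero ψ)
    have hd : (mKind ψ 0 0).isDoubler = true := by rw [mKind_isDoubler]; simp
    exact hmat hV hN (mem_expectedRoles_of_matrix (mKind_isMatrix ψ 0 0) (Or.inr (Or.inr (Or.inr (Or.inr (Or.inr ⟨Or.inl ⟨_, rfl, hb⟩, hd⟩)))))) trivial
  | sconn =>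
    have hN : 1 ≤ N ψ := hs
    have hV : 0 < V ψ := V_pos_of_N_pos ψ hN
    have hd : (mKind ψ 0 0).isDoubler = true := by rw [mKind_isDoubler]; simp
    exact hmat hV hN (mem_expectedRoles_of_matrix (mKind_isMatrix ψ 0 0) (Or.inr (Or.inr (Or.inr (Or.inr (Or.inr ⟨Or.inr rfl, hd⟩)))))) trivial
  | beadV j b =>
    obtain ⟨hj, a, ha, rfl⟩ := hs
    have hb : a.val < 12 := (mem_vertList_iff _ a).1 ha (cellTyAt_clauseBead ψ j)
    exact hcla hj (mem_expectedRoles_of_clause (cKind_isClause ψ j) (Or.inl ⟨_, rfl, hb⟩)) trivial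
  | bconnS j => exact hcla hs (mem_expectedRoles_of_clause (cKind_isClause ψ j) (Or.inr (Or.inl rfl))) trivial
  | tgad i j r code =>
    obtain ⟨hi, hj, hr, spec, hg, -, hcode⟩ := hs
    rw [gad_tile ψ hi hj hr] at hg
    -- which `r`
    have htg := hg
    unfold tileGad at htg
    by_cases hx : tileTy ψ i j = .cross
    · rw [if_pos hx] at htg
      have h00 : ¬ (i = 0 ∧ j = 0) := by rintro ⟨rfl, rfl⟩; exact h00tap (by omega) hx
      have hX : (mKind ψ i j).isCross = true := by rw [mKind_isCross ψ i j h00]; simpa using hx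
      rcases Nat.lt_or_ge r 6 with hr6 | hr6
      · interval_cases r
        · by_cases hj0 : j = 0
          · simp [hj0] at htg
          · simp only [↓reduceIte, if_neg hj0, Option.some.injEq] at htg
            subst htg
            have hj1 : j - 1 < N ψ := by omega
            have hl : (mKind ψ i (j - 1)).isLastCol = false := by rw [mKind_isLastCol]; simp; omega
            have := hmat hi hj1 (mem_expectedRoles_of_matrix (mKind_isMatrix ψ i (j - 1))
              (Or.inr (Or.inr (Or.inr (Or.inl ⟨code, rfl, by simpa [GridFormulaFP.specSize] using hcode, hl⟩))))) trivial
            simpa [ssemM, Nat.sub_add_cancel (Nat.one_le_iff_ne_zero.2 hj0)] using this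
        · norm_num at htg; subst htg
          exact hmat hi hj (mem_expectedRoles_of_matrix (mKind_isMatrix ψ i j)
            (Or.inr (Or.inr (Or.inl ⟨1, code, rfl, by simpa [GridFormulaFP.specSize] using hcode, le_refl _, Or.inl (by norm_num)⟩)))) trivial
        · norm_num at htg; subst htg
          exact hmat hi hj (mem_expectedRoles_of_matrix (mKind_isMatrix ψ i j)
            (Or.inr (Or.inr (Or.inl ⟨2, code, rfl, by simpa [GridFormulaFP.specSize] using hcode, by norm_num, Or.inl (by norm_num)⟩)))) trivial
        · norm_num at htg; subst htg
          exact hmat hi hj (mem_expectedRoles_of_matrix (mKind_isMatrix ψ i j)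
            (Or.inr (Or.inr (Or.inl ⟨3, code, rfl, by simpa [GridFormulaFP.specSize] using hcode, by norm_num, Or.inr ⟨by norm_num, hX⟩⟩)))) trivial
        · norm_num at htg; subst htg
          exact hmat hi hj (mem_expectedRoles_of_matrix (mKind_isMatrix ψ i j)
            (Or.inr (Or.inr (Or.inl ⟨4, code, rfl, by simpa [GridFormulaFP.specSize] using hcode, by norm_num, Or.inr ⟨by norm_num, hX⟩⟩)))) trivial
        · norm_num at htg; subst htg
          obtain ⟨hi1, hco⟩ := cross_above ψ hX
          have := hmat (i := i - 1) (j := j) (by omega) hj (mem_expectedRoles_of_matrix (mKind_isMatrix ψ (i - 1) j)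
            (Or.inr (Or.inr (Or.inr (Or.inr (Or.inl ⟨code, rfl, by simpa [GridFormulaFP.specSize] using hcode, hco⟩)))))) trivial
          simpa [ssemM, Nat.sub_add_cancel hi1, hi] using this
      · simp only [show r ≠ 0 by omega, show r ≠ 1 by omega, show r ≠ 2 by omega, show r ≠ 3 by omega, show r ≠ 4 by omega,
          show r ≠ 5 by omega, ↓reduceIte] at htg
        exact absurd htg (by simp)
    · rw [if_neg hx] at htg
      rcases Nat.lt_or_ge r 3 with hr3 | hr3
      · interval_cases r
        · by_cases hj0 : j = 0
          · simp [hj0] at htg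
          · simp only [↓reduceIte, if_neg hj0, Option.some.injEq] at htg
            subst htg
            have hj1 : j - 1 < N ψ := by omega
            have hl : (mKind ψ i (j - 1)).isLastCol = false := by rw [mKind_isLastCol]; simp; omega
            have := hmat hi hj1 (mem_expectedRoles_of_matrix (mKind_isMatrix ψ i (j - 1))
              (Or.inr (Or.inr (Or.inr (Or.inl ⟨code, rfl, by simpa [GridFormulaFP.specSize] using hcode, hl⟩))))) trivial
            simpa [ssemM, Nat.sub_add_cancel (Nat.one_le_iff_ne_zero.2 hj0)] using this
        · norm_num at htg; subst htg
          exact hmat hi hj (mem_expectedRoles_of_matrix (mKind_isMatrix ψ i j)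
            (Or.inr (Or.inr (Or.inl ⟨1, code, rfl, by simpa [GridFormulaFP.specSize] using hcode, le_refl _, Or.inl (by norm_num)⟩)))) trivial
        · norm_num at htg; subst htg
          exact hmat hi hj (mem_expectedRoles_of_matrix (mKind_isMatrix ψ i j)
            (Or.inr (Or.inr (Or.inl ⟨2, code, rfl, by simpa [GridFormulaFP.specSize] using hcode, by norm_num, Or.inl (by norm_num)⟩)))) trivial
      · simp only [show r ≠ 0 by omega, show r ≠ 1 by omega, show r ≠ 2 by omega, ↓reduceIte] at htg
        exact absurd htg (by simp)
  | landS j code =>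
    obtain ⟨hj, spec, hg, -, hcode⟩ := hs
    rw [gad_land ψ hj] at hg
    obtain rfl := Option.some.inj hg
    have hV : 1 ≤ V ψ := V_pos_of_N_pos ψ (by omega)
    have := hmat (i := V ψ - 1) (j := j) (by omega) hj (mem_expectedRoles_of_matrix (mKind_isMatrix ψ (V ψ - 1) j)
      (Or.inr (Or.inr (Or.inr (Or.inr (Or.inl ⟨code, rfl, by simpa [GridFormulaFP.specSize] using hcode, lastRow_hasCo ψ hj⟩)))))) trivial
    simpa [ssemM, Nat.sub_add_cancel hV] using this
  | orS q code =>
    obtain ⟨hq, spec, hg, -, hcode⟩ := hs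
    rw [gad_clause, clauseGad_eq ψ hq] at hg
    have hcs : ∀ {m : ℕ}, m < ψ[q].length → cstart ψ q + m < N ψ ∧ colClause ψ (cstart ψ q + m) = q ∧
        colInClause ψ (cstart ψ q + m) = m := fun hm =>
      ⟨cstart_add_lt ψ hq hm, colClause_cstart_add ψ hq hm, by unfold colInClause; rw [colClause_cstart_add ψ hq hm]; omega⟩
    rcases hw q hq with h1 | h3
    · rw [if_pos h1] at hg
      obtain rfl := Option.some.inj hg
      simp only [GridFormulaFP.specSize] at hcode
      obtain ⟨hj, hcc, hci⟩ := hcs (m := 0) (by omega)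
      rw [Nat.add_zero] at hj hcc hci
      have hu : isUnitCol ψ (cstart ψ q) = true := by
        unfold isUnitCol; rw [hcc, decide_eq_true_eq, getD_map_length' ψ hq]; exact h1
      have hU : (cKind ψ (cstart ψ q)).isUnitK = true := by rw [cKind_isUnitK, hu]
      by_cases hc2 : code < 2
      · have := hcla hj (mem_expectedRoles_of_clause (cKind_isClause ψ _) (Or.inr (Or.inr (Or.inl ⟨code, rfl, by rw [hU]; simpa using hc2⟩)))) trivial
        simpa [ssemC, hu, hcc] using this
      · have := hcla hj (mem_expectedRoles_of_clause (cKind_isClause ψ _) (Or.inr (Or.inr (Or.inr rfl)))) trivial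
        have hc : code = 2 := by omega
        subst hc
        simpa [ssemC, hu, hcc] using this
    · rw [if_neg (by omega), if_pos h3] at hg
      obtain rfl := Option.some.inj hg
      simp only [GridFormulaFP.specSize] at hcode
      have hnu : ∀ {m : ℕ}, m < 3 → isUnitCol ψ (cstart ψ q + m) = false := fun {m} hm => by
        obtain ⟨-, hcc, -⟩ := hcs (m := m) (by omega)
        unfold isUnitCol; rw [hcc, getD_map_length' ψ hq, h3]; simp
      by_cases h18 : code < 18
      · obtain ⟨hj, hcc, hci⟩ := hcs (m := code / 6) (by omega)
        have hU : (cKind ψ (cstart ψ q + code / 6)).isUnitK = false := by rw [cKind_isUnitK, hnu (by omega)]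
        have := hcla hj (mem_expectedRoles_of_clause (cKind_isClause ψ _)
          (Or.inr (Or.inr (Or.inl ⟨code % 6, rfl, by rw [hU]; simp; omega⟩)))) trivial
        simp only [ssemC, hnu (show code / 6 < 3 by omega), Bool.false_eq_true, ↓reduceIte, hcc, hci] at this
        rwa [show 6 * (code / 6) + code % 6 = code from Nat.div_add_mod code 6] at this
      · by_cases h21 : code < 21
        · obtain ⟨hj, hcc, hci⟩ := hcs (m := code - 18) (by omega)
          have := hcla hj (mem_expectedRoles_of_clause (cKind_isClause ψ _) (Or.inr (Or.inr (Or.inr rfl)))) trivial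
          simp only [ssemC, hnu (show code - 18 < 3 by omega), Bool.false_eq_true, ↓reduceIte, hcc, hci] at this
          rwa [show 18 + (code - 18) = code by omega] at this
        · have hrq : q ∈ rungClauses ψ := (mem_rungClauses_iff ψ).2 ⟨hq, by rw [getD_map_length' ψ hq, h3]⟩
          obtain ⟨idx, hidx, hn⟩ := exists_idx_of_expected (P := rungP ψ q) rfl (rName ψ q) (fun _ => rfl)
            (mem_expectedRoles_of_rung ⟨by omega, hcode⟩)
          exact ⟨_, (mem_placements_iff ψ).2 (Or.inr (Or.inr ⟨q, hrq, rfl⟩)), idx, hidx, hn⟩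

end SSem

/-! ### Every listed vertex is a structured vertex -/

/-- Decoding a cell index of a tile cell. [folklore] -/
theorem tileCell_decode {kc : ℕ} (h1 : 1 ≤ kc) (h2 : kc < 1 + 3 * (V ψ * N ψ)) :
    (kc - 1) / 3 / N ψ < V ψ ∧ (kc - 1) / 3 % N ψ < N ψ ∧ (kc - 1) % 3 ≤ 2 ∧
      tileCell ψ ((kc - 1) / 3 / N ψ) ((kc - 1) / 3 % N ψ) ((kc - 1) % 3) = kc := by
  have hN : 0 < N ψ := Nat.pos_of_ne_zero fun h => by rw [h] at h2; simp at h2; omega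
  refine ⟨?_, Nat.mod_lt _ hN, by omega, ?_⟩
  · rw [Nat.div_lt_iff_lt_mul hN]; omega
  · unfold tileCell
    have h3 := Nat.div_add_mod (kc - 1) 3
    have hN' := Nat.div_add_mod ((kc - 1) / 3) (N ψ)
    rw [Nat.mul_comm ((kc - 1) / 3 / N ψ) (N ψ), hN']
    omega

/-- Decoding a tile gadget index. [folklore] -/
theorem tileGadIdx_decode {g : ℕ} (hg : g < 8 * (V ψ * N ψ)) :
    g / 8 / N ψ < V ψ ∧ g / 8 % N ψ < N ψ ∧ g % 8 < 8 ∧ 8 * (g / 8 / N ψ * N ψ + g / 8 % N ψ) + g % 8 = g := by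
  have hN : 0 < N ψ := Nat.pos_of_ne_zero fun h => by rw [h] at hg; simp at hg
  refine ⟨?_, Nat.mod_lt _ hN, Nat.mod_lt _ (by norm_num), ?_⟩
  · rw [Nat.div_lt_iff_lt_mul hN]; omega
  · rw [Nat.div_add_mod' (g / 8) (N ψ)]; omega

/-- **Every listed vertex is the number of a structured vertex that is a vertex.** [folklore] -/
theorem exists_vtx_of_mem (hN : 1 ≤ N ψ) {v : ℕ} (hv : v ∈ vertsListOf ψ) : ∃ s : SSem, s.Vtx ψ ∧ v = SSem.encS ψ s := by
  rcases (mem_vertsListOf_iff ψ).1 hv with hv | ⟨g, hg, hv⟩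
  · obtain ⟨kc, hk, hv⟩ := (mem_chainVertsN_iff' ψ).1 hv
    by_cases h0 : kc = 0
    · subst h0
      rcases hv with rfl | ⟨a, ha, rfl⟩
      · exact ⟨.sconn, hN, rfl⟩
      · exact ⟨.dcellV a.val, ⟨hN, a, ha, rfl⟩, by simp [SSem.encS, GridCell.vtx]⟩
    · by_cases h1 : kc < 1 + 3 * (V ψ * N ψ)
      · obtain ⟨hi, hj, hc, hkc⟩ := tileCell_decode ψ (Nat.one_le_iff_ne_zero.2 h0) h1
        rcases hv with rfl | ⟨a, ha, rfl⟩
        · exact ⟨.tconn _ _ _, ⟨hi, hj, hc⟩, by simp only [SSem.encS, hkc]; rfl⟩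
        · exact ⟨.cellV _ _ _ a.val, ⟨hi, hj, hc, a, by rw [hkc]; exact ha, rfl⟩, by simp only [SSem.encS, hkc]; rfl⟩
      · have hj : kc - (1 + 3 * (V ψ * N ψ)) < N ψ := by unfold ncells at hk; omega
        have hkc : clauseBead ψ (kc - (1 + 3 * (V ψ * N ψ))) = kc := by unfold clauseBead; omega
        rcases hv with rfl | ⟨a, ha, rfl⟩
        · exact ⟨.bconnS _, hj, by simp only [SSem.encS, hkc]; rfl⟩
        · exact ⟨.beadV _ a.val, ⟨hj, a, by rw [hkc]; exact ha, rfl⟩, by simp only [SSem.encS, hkc]; rfl⟩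
  · obtain ⟨spec, hs, hok, code, hcode, rfl⟩ := (mem_placeVerts_iff' ψ).1 hv
    have hng : ngadgets ψ = 8 * (V ψ * N ψ) + N ψ + ψ.length := rfl
    by_cases h1 : g < 8 * (V ψ * N ψ)
    · obtain ⟨hi, hj, hr, hgg⟩ := tileGadIdx_decode ψ h1
      exact ⟨.tgad _ _ _ code, ⟨hi, hj, hr, spec, by rw [hgg]; exact hs, hok, hcode⟩, by simp only [SSem.encS, hgg]⟩
    · by_cases h2 : g < 8 * (V ψ * N ψ) + N ψ
      · have hgg : 8 * (V ψ * N ψ) + (g - 8 * (V ψ * N ψ)) = g := by omega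
        exact ⟨.landS (g - 8 * (V ψ * N ψ)) code, ⟨by omega, spec, by rw [hgg]; exact hs, hok, hcode⟩, by simp only [SSem.encS, hgg]⟩
      · have hgg : 8 * (V ψ * N ψ) + N ψ + (g - 8 * (V ψ * N ψ) - N ψ) = g := by omega
        exact ⟨.orS (g - 8 * (V ψ * N ψ) - N ψ) code, ⟨by rw [hng] at hg; omega, spec, by rw [hgg]; exact hs, hok, hcode⟩,
          by simp only [SSem.encS, hgg]⟩

/-- **Every listed vertex is placed** (`TilingHypsGeo.cover`), for formulas in normal-form widths. [folklore] -/
theorem cover (hw : ∀ q (hq : q < ψ.length), ψ[q].length = 1 ∨ ψ[q].length = 3) (hN : 1 ≤ N ψ) :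
    ∀ v ∈ vertsListOf ψ, ∃ P ∈ placements ψ, ∃ i, i < P.T.nv ∧ P.ν i = v := by
  intro v hv
  obtain ⟨s, hs, rfl⟩ := exists_vtx_of_mem ψ hN hv
  obtain ⟨P, hP, idx, hidx, hn⟩ := hs.named hw
  exact ⟨P, hP, idx, hidx, hn⟩

/-! ### No repetitions -/

/-- Three-literal clauses are listed once. [folklore] -/
theorem rungClauses_nodup : (rungClauses ψ).Nodup := by
  unfold rungClauses; exact (List.nodup_range).filter _

/-- **The placements are listed once.** [folklore] -/
theorem placements_nodup : (placements ψ).Nodup := by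
  have hoM : ∀ i j, (matrixP ψ i j).o = (((72 * j : ℕ) : ℤ), -((54 * (i + 1) : ℕ) : ℤ)) := fun i j => rfl
  have hoC : ∀ j, (clauseP ψ j).o = (((72 * j : ℕ) : ℤ), yClause ψ) := fun j => rfl
  have hoR : ∀ q, (rungP ψ q).o = (((72 * cstart ψ q : ℕ) : ℤ), yClause ψ - 8) := fun q => rfl
  have hy := yClause_eq ψ
  have hMM : ∀ {i j i' j' : ℕ}, matrixP ψ i j = matrixP ψ i' j' → i = i' ∧ j = j' := fun h => by
    have h1 := congrArg (fun P : Placement => P.o.1) h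
    have h2 := congrArg (fun P : Placement => P.o.2) h
    simp only [hoM] at h1 h2; omega
  have hCC : ∀ {j j' : ℕ}, clauseP ψ j = clauseP ψ j' → j = j' := fun h => by
    have h1 := congrArg (fun P : Placement => P.o.1) h
    simp only [hoC] at h1; omega
  have hRR : ∀ {q q' : ℕ}, q ∈ rungClauses ψ → q' ∈ rungClauses ψ → rungP ψ q = rungP ψ q' → q = q' :=
    fun hq hq' h => by
    have h1 := congrArg (fun P : Placement => P.o.1) h
    simp only [hoR] at h1
    by_contra hne
    rcases Nat.lt_or_gt_of_ne hne with hlt | hlt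
    · have := cstart_apart ψ hq hq' hlt; omega
    · have := cstart_apart ψ hq' hq hlt; omega
  have hMC : ∀ {i j j' : ℕ}, matrixP ψ i j ≠ clauseP ψ j' := fun h => by
    have h2 := congrArg (fun P : Placement => P.o.2) h
    simp only [hoM, hoC, hy] at h2; omega
  have hMR : ∀ {i j q : ℕ}, matrixP ψ i j ≠ rungP ψ q := fun h => by
    have h2 := congrArg (fun P : Placement => P.o.2) h
    simp only [hoM, hoR, hy] at h2; omega
  have hCR : ∀ {j q : ℕ}, clauseP ψ j ≠ rungP ψ q := fun h => by
    have h2 := congrArg (fun P : Placement => P.o.2) h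
    simp only [hoC, hoR] at h2; omega
  unfold placements
  refine List.nodup_append.2 ⟨?_, List.nodup_append.2 ⟨?_, ?_, ?_⟩, ?_⟩
  · rw [List.nodup_flatMap]
    refine ⟨fun i _ => (List.nodup_range).map_on fun j _ j' _ h => (hMM h).2, ?_⟩
    refine List.nodup_range.pairwise_of_forall_ne fun i _ i' _ hne => ?_
    intro P h1 h2
    obtain ⟨j, -, rfl⟩ := List.mem_map.1 h1
    obtain ⟨j', -, h⟩ := List.mem_map.1 h2
    exact hne (hMM h).1.symm
  · exact (List.nodup_range).map_on fun j _ j' _ h => hCC h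
  · exact (rungClauses_nodup ψ).map_on fun q hq q' hq' h => hRR hq hq' h
  · intro P hP Q hQ hPQ
    obtain ⟨j, -, rfl⟩ := List.mem_map.1 hP
    obtain ⟨q, -, rfl⟩ := List.mem_map.1 hQ
    exact hCR hPQ
  · intro P hP Q hQ hPQ
    obtain ⟨i, -, hP⟩ := List.mem_flatMap.1 hP
    obtain ⟨j, -, rfl⟩ := List.mem_map.1 hP
    rcases List.mem_append.1 hQ with hQ | hQ
    · obtain ⟨j', -, rfl⟩ := List.mem_map.1 hQ; exact hMC hPQ
    · obtain ⟨q, -, rfl⟩ := List.mem_map.1 hQ; exact hMR hPQ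

/-- Chain vertices are below `17 · ncells`, gadget vertices are not. [folklore] -/
theorem lt_of_mem_chainVertsN {v : ℕ} (hv : v ∈ chainVertsN ψ) : v < 17 * ncells ψ := by
  obtain ⟨kc, hk, rfl | ⟨a, -, rfl⟩⟩ := (mem_chainVertsN_iff' ψ).1 hv
  · unfold GridCell.conn; omega
  · unfold GridCell.vtx; have := a.isLt; omega

/-- **The vertex list has no repetitions** (`TilingHypsGeo.nodup_verts`). [folklore] -/
theorem vertsListOf_nodup : (vertsListOf ψ).Nodup := by
  unfold GridFormulaFP.vertsListOf
  refine List.nodup_append.2 ⟨?_, ?_, ?_⟩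
  · unfold GridFormulaFP.chainVertsN
    rw [List.nodup_flatMap]
    refine ⟨fun kc _ => List.nodup_cons.2 ⟨?_, ((cellTyAt ψ kc).vertList_nodup).map (GridCell.vtx_injective kc)⟩, ?_⟩
    · simp only [List.mem_map, not_exists, not_and]
      exact fun a _ h => GridCell.vtx_ne_conn kc kc a h
    · refine List.nodup_range.pairwise_of_forall_ne fun kc _ kc' _ hne => ?_
      have hdiv : ∀ {k v : ℕ}, v ∈ conn k :: (cellTyAt ψ k).vertList.map (vtx k) → v / 17 = k := by
        intro k v hv
        rcases List.mem_cons.1 hv with rfl | hv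
        · exact GridCell.conn_div k
        · obtain ⟨a, -, rfl⟩ := List.mem_map.1 hv; exact GridCell.vtx_div k a
      intro v h1 h2
      exact hne ((hdiv h1).symm.trans (hdiv h2))
  · rw [List.nodup_flatMap]
    refine ⟨fun g _ => ?_, ?_⟩
    · rw [placeVerts_eq]
      cases gad ψ g with
      | none => exact List.nodup_nil
      | some spec =>
        simp only [Option.elim_some]
        split_ifs
        · exact (List.nodup_range).map fun a b h => by simpa using h
        · exact List.nodup_nil
    · refine List.nodup_range.pairwise_of_forall_ne fun g _ g' _ hne => ?_
      intro v h1 h2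
      obtain ⟨s, -, -, code, hc, rfl⟩ := (mem_placeVerts_iff' ψ).1 h1
      obtain ⟨s', -, -, code', hc', h⟩ := (mem_placeVerts_iff' ψ).1 h2
      have := SSem.specSize_lt s; have := SSem.specSize_lt s'
      unfold gbase at h; omega
  · intro v hv w hw hvw
    subst hvw
    obtain ⟨g, -, hg⟩ := List.mem_flatMap.1 hw
    have h1 := lt_of_mem_chainVertsN ψ hv
    obtain ⟨s, -, -, code, -, rfl⟩ := (mem_placeVerts_iff' ψ).1 hg
    unfold gbase at h1; omega

end FormulaTiles

end Literature.Barriers.CriticalPhenomena.GridSAW
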